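import Summits.CriticalPhenomena.PercolationContinuityZ3.Theorems.PercNearOneGluingNoHeavyQuantFiveAtomsHeavyB
import Summits.CriticalPhenomena.PercolationContinuityZ3.Theorems.PercNearOneGluingNoHeavyQuantFiveAtomsHeavyC
import Summits.CriticalPhenomena.PercolationContinuityZ3.Theorems.PercNearOneGluingNoHeavyQuantLightPairCornerWitness
import HarnessLib

/-!
# QUANT lane R8, T-DEC: FOUR BLOBS WITH ARBITRARY GATES ARE HEAVY-DEC AT THEIR AVERAGE GATE — BLOB-AFL(4) for every gate vector;
# the five capacities and the separator of the five-atom regimes discharged by exact symmetric LP certificates (prim-quant-census-2 gen 81)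

builds on p205010 (kernel theorem, internal audit signed; external expert review pending)

Support file (`--supports stmt-CriticalPhenomena-4575`), QUANT lane census seat prim-quant-census-2 (gen 81); memo
`run/shared/lean/prim/quant/prim-quant-census-2-g81/AFL-G81.md` §3 items 13–14.  Theorems only, standard axioms, no sorries, no definitions.

Census-2 g80's `heavy_fourBlobs` (`…QuantFourBlobAverageFloor`) proves the average-floor blob lemma for FOUR blobs with gates `(g,g,g,cg)` from the
ABSTRACT five-atom regime lemmas `heavy_fiveAtoms_r1/r2/r3lo/r3hi/r4` (any law on `{0,k,2k,3k,4k}` of mean `s·k`, floor `s/4`, with capacity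
hypotheses `hC2, hZ, hO, hA, hS` and the separator `hA ∨ hOne`).  Here the gates `g₁..g₄ ∈ [0,1]` are ARBITRARY (`0 < s = Σgᵢ < 4`, blob size `k`):
the capacities are polynomial inequalities in four variables, each proved by an identity `margin = (positive scalar)·Σ λ_t·(product of nonnegative
factors)` found by an exact rational LP over S₄-symmetrised products of `gᵢ`, `1−gᵢ`, `(gᵢ−gⱼ)²` and the regime factors (memo §3 item 13; census
first: 0 violations of all six on 230 000 random + grid gate vectors):
* `fourGates_capacity_C2` (`2 ≤ s ≤ 8/3`), `fourGates_capacity_Z` (`2 ≤ s ≤ 3`), `fourGates_capacity_O` (`8/3 ≤ s ≤ 3`), `fourGates_capacity_A`,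
  `fourGates_capacity_S` (`3 ≤ s`), and the separator `fourGates_capacity_Sep`: in the case `p₄ ≤ 3p₀` 'one fits' (`(s−2)p₁ ≤ (3−s)p₂`); in the
  case `p₄ ≥ 3p₀` 'zero fits' trivially (`s < 3`).
* `blobLaw_four_apply` — the five atoms `p₀..p₄` of `blobLaw [(k,g₁),(k,g₂),(k,g₃),(k,g₄)]` as symmetric polynomials.
* **`heavy_fourBlobs_gates`** — BLOB-AFL(4) for EVERY gate vector: heavy at floor `s/4` (average gate), target `s·k`; `decAtT_fourBlobs_gates` (every layer).
With `heavy_blobLaw_of_mean_le_two` (every width, `s ≤ 2`), `heavy_threeBlobs_gates` (n = 3) and `heavy_blobLaw_replicate_of_half_le` (equal gates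
`≥ 1/2`, every width), conjecture BLOB-AFL (`…/prim-quant-census-2-g80/TRIPLE-G80.md` §5) is now kernel for every gate vector up to width 4.

HONEST STATUS.  BLOB-AFL for `n ≥ 5` is open in the middle band (memo §3.5); `SiblingStep`, `FarTreeRow` OPEN; RATE class (log\*) / honest sentence of
`run/shared/lean/prim/quant/README.md` unchanged.  [this work].  Nothing here is cited as a published result.  The gluing rows served
[cite: KozmaNitzan2024, Conjecture 3 (p. 15)]; product measure [cite: Grimmett1999, §1.3 p. 10].
-/

noncomputable section

open scoped BigOperators

namespace Summit.CriticalPhenomena.PercolationContinuityZ3.Theorems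
namespace Quant

open Finset

/-- the two-point law `{lo, hi; g}` (as in `…QuantLawDEC`) -/
local notation3 "TP[" lo ", " hi ", " g ", " h "]" =>
  (g : ℝ) * (if (h : ℕ) = (hi : ℕ) then (1 : ℝ) else 0) + (1 - (g : ℝ)) * (if (h : ℕ) = (lo : ℕ) then (1 : ℝ) else 0)

namespace LawDec

/-! ### The five capacities and the separator, four arbitrary gates -/

/-- **capacity `hA` of `heavy_fiveAtoms_r4` for FOUR ARBITRARY GATES (regime `3 ≤ s`): `s/4·p₀ ≤ (1−s/4)·p₄`**.  `uᵢ = 1 − gᵢ`; the certificate (6 S₄-symmetric terms, 26 products) is an exact LP solution over symmetrised products of the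
nonnegative factors; `ring` checks the identity. [this work] -/
theorem fourGates_capacity_A {g₁ g₂ g₃ g₄ : ℝ} (h10 : 0 ≤ g₁) (h11 : g₁ ≤ 1) (h20 : 0 ≤ g₂) (h21 : g₂ ≤ 1) (h30 : 0 ≤ g₃) (h31 : g₃ ≤ 1) (h40 : 0 ≤ g₄) (h41 : g₄ ≤ 1) (hs3 : 3 ≤ g₁ + g₂ + g₃ + g₄) :
    (g₁ + g₂ + g₃ + g₄) / 4 * ((1 - g₁) * (1 - g₂) * (1 - g₃) * (1 - g₄))
      ≤ (1 - (g₁ + g₂ + g₃ + g₄) / 4) * (g₁ * g₂ * g₃ * g₄) := by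
  have key : (1 - (g₁ + g₂ + g₃ + g₄) / 4) * (g₁ * g₂ * g₃ * g₄) - (g₁ + g₂ + g₃ + g₄) / 4 * ((1 - g₁) * (1 - g₂) * (1 - g₃) * (1 - g₄))
      = ((1 : ℝ) / 4) * (((5 : ℝ) / 16) * ((1 - g₁) * g₁ + (1 - g₂) * g₂ + (1 - g₃) * g₃ + (1 - g₄) * g₄)
        + ((3 : ℝ) / 8) * ((1 - g₁) * (1 - g₁) * g₁ + (1 - g₂) * (1 - g₂) * g₂ + (1 - g₃) * (1 - g₃) * g₃ + (1 - g₄) * (1 - g₄) * g₄)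
        + ((3 : ℝ) / 8) * ((1 - g₁) * g₁ * ((g₁ + g₂ + g₃ + g₄) - 3) + (1 - g₂) * g₂ * ((g₁ + g₂ + g₃ + g₄) - 3) + (1 - g₃) * g₃ * ((g₁ + g₂ + g₃ + g₄) - 3) + (1 - g₄) * g₄ * ((g₁ + g₂ + g₃ + g₄) - 3))
        + ((3 : ℝ) / 16) * ((1 - g₁) * (1 - g₂) * (1 - g₃) * g₄ * ((g₁ + g₂ + g₃ + g₄) - 3) + (1 - g₁) * (1 - g₂) * g₃ * (1 - g₄) * ((g₁ + g₂ + g₃ + g₄) - 3) + (1 - g₁) * g₂ * (1 - g₃) * (1 - g₄) * ((g₁ + g₂ + g₃ + g₄) - 3) + g₁ * (1 - g₂) * (1 - g₃) * (1 - g₄) * ((g₁ + g₂ + g₃ + g₄) - 3))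
        + ((5 : ℝ) / 16) * ((1 - g₁) * g₂ * g₃ * g₄ * ((g₁ + g₂ + g₃ + g₄) - 3) + g₁ * (1 - g₂) * g₃ * g₄ * ((g₁ + g₂ + g₃ + g₄) - 3) + g₁ * g₂ * (1 - g₃) * g₄ * ((g₁ + g₂ + g₃ + g₄) - 3) + g₁ * g₂ * g₃ * (1 - g₄) * ((g₁ + g₂ + g₃ + g₄) - 3))
        + ((1 : ℝ) / 8) * ((1 - g₃) * (1 - g₄) * (g₁ - g₂) ^ 2 + (1 - g₂) * (1 - g₄) * (g₁ - g₃) ^ 2 + (1 - g₂) * (1 - g₃) * (g₁ - g₄) ^ 2 + (1 - g₁) * (1 - g₄) * (g₂ - g₃) ^ 2 + (1 - g₁) * (1 - g₃) * (g₂ - g₄) ^ 2 + (1 - g₁) * (1 - g₂) * (g₃ - g₄) ^ 2)) := by ring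
  rw [← sub_nonneg, key]
  have hu1 : 0 ≤ 1 - g₁ := by linarith
  have hu2 : 0 ≤ 1 - g₂ := by linarith
  have hu3 : 0 ≤ 1 - g₃ := by linarith
  have hu4 : 0 ≤ 1 - g₄ := by linarith
  have hr1 : 0 ≤ ((g₁ + g₂ + g₃ + g₄) - 3) := by linarith
  exact mul_nonneg (by positivity) (add_nonneg (add_nonneg (add_nonneg (add_nonneg (add_nonneg (mul_nonneg (by norm_num) (add_nonneg (add_nonneg (add_nonneg (mul_nonneg hu1 h10) (mul_nonneg hu2 h20)) (mul_nonneg hu3 h30)) (mul_nonneg hu4 h40))) (mul_nonneg (by norm_num) (add_nonneg (add_nonneg (add_nonneg (mul_nonneg (mul_nonneg hu1 hu1) h10) (mul_nonneg (mul_nonneg hu2 hu2) h20)) (mul_nonneg (mul_nonneg hu3 hu3) h30)) (mul_nonneg (mul_nonneg hu4 hu4) h40)))) (mul_nonneg (by norm_num) (add_nonneg (add_nonneg (add_nonneg (mul_nonneg (mul_nonneg hu1 h10) hr1) (mul_nonneg (mul_nonneg hu2 h20) hr1)) (mul_nonneg (mul_nonneg hu3 h30) hr1)) (mul_nonneg (mul_nonneg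 hu4 h40) hr1)))) (mul_nonneg (by norm_num) (add_nonneg (add_nonneg (add_nonneg (mul_nonneg (mul_nonneg (mul_nonneg (mul_nonneg hu1 hu2) hu3) h40) hr1) (mul_nonneg (mul_nonneg (mul_nonneg (mul_nonneg hu1 hu2) h30) hu4) hr1)) (mul_nonneg (mul_nonneg (mul_nonneg (mul_nonneg hu1 h20) hu3) hu4) hr1)) (mul_nonneg (mul_nonneg (mul_nonneg (mul_nonneg h10 hu2) hu3) hu4) hr1)))) (mul_nonneg (by norm_num) (add_nonneg (add_nonneg (add_nonneg (mul_nonneg (mul_nonneg (mul_nonneg (mul_nonneg hu1 h20) h30) h40) hr1) (mul_nonneg (mul_nonneg (mul_nonneg (mul_nonneg h10 hu2) h30) h40) hr1)) (mul_nonneg (mul_nonneg (mul_nonneg (mul_nonneg h10 h20) hu3) h40) hr1)) (mul_nonneg (mul_nonneg (mul_nonneg (mul_nonneg h10 h20) h30) hu4) hr1)))) (mul_nonneg (by norm_num) (add_nonneg (add_nonneg (add_nonneg (add_nonneg (add_nonneg (mul_nonneg (mul_nonneg hu3 hu4) (sq_nonneg (g₁ - g₂))) (mul_nonneg (mul_nonneg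 hu2 hu4) (sq_nonneg (g₁ - g₃)))) (mul_nonneg (mul_nonneg hu2 hu3) (sq_nonneg (g₁ - g₄)))) (mul_nonneg (mul_nonneg hu1 hu4) (sq_nonneg (g₂ - g₃)))) (mul_nonneg (mul_nonneg hu1 hu3) (sq_nonneg (g₂ - g₄)))) (mul_nonneg (mul_nonneg hu1 hu2) (sq_nonneg (g₃ - g₄))))))

/-- **capacity `hS` of `heavy_fiveAtoms_r4` for four arbitrary gates (regime `3 ≤ s`): `s/4·p₁ ≤ (1−s/4)·p₃`**.  `uᵢ = 1 − gᵢ`; the certificate (4 S₄-symmetric terms, 17 products) is an exact LP solution over symmetrised products of the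
nonnegative factors; `ring` checks the identity. [this work] -/
theorem fourGates_capacity_S {g₁ g₂ g₃ g₄ : ℝ} (h10 : 0 ≤ g₁) (h11 : g₁ ≤ 1) (h20 : 0 ≤ g₂) (h21 : g₂ ≤ 1) (h30 : 0 ≤ g₃) (h31 : g₃ ≤ 1) (h40 : 0 ≤ g₄) (h41 : g₄ ≤ 1) (hs3 : 3 ≤ g₁ + g₂ + g₃ + g₄) :
    (g₁ + g₂ + g₃ + g₄) / 4 * (g₁ * (1 - g₂) * (1 - g₃) * (1 - g₄) + (1 - g₁) * g₂ * (1 - g₃) * (1 - g₄) + (1 - g₁) * (1 - g₂) * g₃ * (1 - g₄) + (1 - g₁) * (1 - g₂) * (1 - g₃) * g₄)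
      ≤ (1 - (g₁ + g₂ + g₃ + g₄) / 4) * ((1 - g₁) * g₂ * g₃ * g₄ + g₁ * (1 - g₂) * g₃ * g₄ + g₁ * g₂ * (1 - g₃) * g₄ + g₁ * g₂ * g₃ * (1 - g₄)) := by
  have key : (1 - (g₁ + g₂ + g₃ + g₄) / 4) * ((1 - g₁) * g₂ * g₃ * g₄ + g₁ * (1 - g₂) * g₃ * g₄ + g₁ * g₂ * (1 - g₃) * g₄ + g₁ * g₂ * g₃ * (1 - g₄)) - (g₁ + g₂ + g₃ + g₄) / 4 * (g₁ * (1 - g₂) * (1 - g₃) * (1 - g₄) + (1 - g₁) * g₂ * (1 - g₃) * (1 - g₄) + (1 - g₁) * (1 - g₂) * g₃ * (1 - g₄) + (1 - g₁) * (1 - g₂) * (1 - g₃) * g₄)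
      = ((1 : ℝ) / 4) * ((1 : ℝ) * ((1 - g₁) * (1 - g₁) + (1 - g₂) * (1 - g₂) + (1 - g₃) * (1 - g₃) + (1 - g₄) * (1 - g₄))
        + (8 : ℝ) * ((1 - g₁) * (1 - g₂) * (1 - g₃) * (1 - g₄))
        + ((2 : ℝ) / 3) * ((1 - g₁) * (1 - g₂) * ((g₁ + g₂ + g₃ + g₄) - 3) + (1 - g₁) * (1 - g₃) * ((g₁ + g₂ + g₃ + g₄) - 3) + (1 - g₁) * (1 - g₄) * ((g₁ + g₂ + g₃ + g₄) - 3) + (1 - g₂) * (1 - g₃) * ((g₁ + g₂ + g₃ + g₄) - 3) + (1 - g₂) * (1 - g₄) * ((g₁ + g₂ + g₃ + g₄) - 3) + (1 - g₃) * (1 - g₄) * ((g₁ + g₂ + g₃ + g₄) - 3))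
        + ((4 : ℝ) / 3) * ((1 - g₁) * (1 - g₂) * g₃ * g₄ * ((g₁ + g₂ + g₃ + g₄) - 3) + (1 - g₁) * g₂ * (1 - g₃) * g₄ * ((g₁ + g₂ + g₃ + g₄) - 3) + (1 - g₁) * g₂ * g₃ * (1 - g₄) * ((g₁ + g₂ + g₃ + g₄) - 3) + g₁ * (1 - g₂) * (1 - g₃) * g₄ * ((g₁ + g₂ + g₃ + g₄) - 3) + g₁ * (1 - g₂) * g₃ * (1 - g₄) * ((g₁ + g₂ + g₃ + g₄) - 3) + g₁ * g₂ * (1 - g₃) * (1 - g₄) * ((g₁ + g₂ + g₃ + g₄) - 3))) := by ring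
  rw [← sub_nonneg, key]
  have hu1 : 0 ≤ 1 - g₁ := by linarith
  have hu2 : 0 ≤ 1 - g₂ := by linarith
  have hu3 : 0 ≤ 1 - g₃ := by linarith
  have hu4 : 0 ≤ 1 - g₄ := by linarith
  have hr1 : 0 ≤ ((g₁ + g₂ + g₃ + g₄) - 3) := by linarith
  exact mul_nonneg (by positivity) (add_nonneg (add_nonneg (add_nonneg (mul_nonneg (by norm_num) (add_nonneg (add_nonneg (add_nonneg (mul_nonneg hu1 hu1) (mul_nonneg hu2 hu2)) (mul_nonneg hu3 hu3)) (mul_nonneg hu4 hu4))) (mul_nonneg (by norm_num) (mul_nonneg (mul_nonneg (mul_nonneg hu1 hu2) hu3) hu4))) (mul_nonneg (by norm_num) (add_nonneg (add_nonneg (add_nonneg (add_nonneg (add_nonneg (mul_nonneg (mul_nonneg hu1 hu2) hr1) (mul_nonneg (mul_nonneg hu1 hu3) hr1)) (mul_nonneg (mul_nonneg hu1 hu4) hr1)) (mul_nonneg (mul_nonneg hu2 hu3) hr1)) (mul_nonneg (mul_nonneg hu2 hu4) hr1)) (mul_nonneg (mul_nonneg hu3 hu4) hr1)))) (mul_nonneg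 (by norm_num) (add_nonneg (add_nonneg (add_nonneg (add_nonneg (add_nonneg (mul_nonneg (mul_nonneg (mul_nonneg (mul_nonneg hu1 hu2) h30) h40) hr1) (mul_nonneg (mul_nonneg (mul_nonneg (mul_nonneg hu1 h20) hu3) h40) hr1)) (mul_nonneg (mul_nonneg (mul_nonneg (mul_nonneg hu1 h20) h30) hu4) hr1)) (mul_nonneg (mul_nonneg (mul_nonneg (mul_nonneg h10 hu2) hu3) h40) hr1)) (mul_nonneg (mul_nonneg (mul_nonneg (mul_nonneg h10 hu2) h30) hu4) hr1)) (mul_nonneg (mul_nonneg (mul_nonneg (mul_nonneg h10 h20) hu3) hu4) hr1))))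

/-- **capacity `hC2` of `heavy_fiveAtoms_r3lo` for four arbitrary gates (regime `2 ≤ s ≤ 8/3`)**.  `uᵢ = 1 − gᵢ`; the certificate (4 S₄-symmetric terms, 18 products) is an exact LP solution over symmetrised products of the
nonnegative factors; `ring` checks the identity. [this work] -/
theorem fourGates_capacity_C2 {g₁ g₂ g₃ g₄ : ℝ} (h10 : 0 ≤ g₁) (h11 : g₁ ≤ 1) (h20 : 0 ≤ g₂) (h21 : g₂ ≤ 1) (h30 : 0 ≤ g₃) (h31 : g₃ ≤ 1) (h40 : 0 ≤ g₄) (h41 : g₄ ≤ 1) (hs83 : g₁ + g₂ + g₃ + g₄ ≤ 8 / 3) (hs2 : 2 ≤ g₁ + g₂ + g₃ + g₄) :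
    (g₁ + g₂ + g₃ + g₄) / 4 * (g₁ * (1 - g₂) * (1 - g₃) * (1 - g₄) + (1 - g₁) * g₂ * (1 - g₃) * (1 - g₄) + (1 - g₁) * (1 - g₂) * g₃ * (1 - g₄) + (1 - g₁) * (1 - g₂) * (1 - g₃) * g₄)
      ≤ (1 - (g₁ + g₂ + g₃ + g₄) / 4) * (g₁ * g₂ * (1 - g₃) * (1 - g₄) + g₁ * (1 - g₂) * g₃ * (1 - g₄) + g₁ * (1 - g₂) * (1 - g₃) * g₄ + (1 - g₁) * g₂ * g₃ * (1 - g₄) + (1 - g₁) * g₂ * (1 - g₃) * g₄ + (1 - g₁) * (1 - g₂) * g₃ * g₄) := by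
  have key : (1 - (g₁ + g₂ + g₃ + g₄) / 4) * (g₁ * g₂ * (1 - g₃) * (1 - g₄) + g₁ * (1 - g₂) * g₃ * (1 - g₄) + g₁ * (1 - g₂) * (1 - g₃) * g₄ + (1 - g₁) * g₂ * g₃ * (1 - g₄) + (1 - g₁) * g₂ * (1 - g₃) * g₄ + (1 - g₁) * (1 - g₂) * g₃ * g₄) - (g₁ + g₂ + g₃ + g₄) / 4 * (g₁ * (1 - g₂) * (1 - g₃) * (1 - g₄) + (1 - g₁) * g₂ * (1 - g₃) * (1 - g₄) + (1 - g₁) * (1 - g₂) * g₃ * (1 - g₄) + (1 - g₁) * (1 - g₂) * (1 - g₃) * g₄)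
      = ((1 : ℝ) / 4) * (((8 : ℝ) / 3) * ((1 - g₁) * (1 - g₂) * (1 - g₃) * (1 - g₄))
        + (2 : ℝ) * ((1 - g₁) * (1 - g₂) * (1 - g₃) * (1 - g₄) * (8 / 3 - (g₁ + g₂ + g₃ + g₄)))
        + (1 : ℝ) * ((1 - g₁) * (1 - g₂) * (1 - g₃) * ((g₁ + g₂ + g₃ + g₄) - 2) + (1 - g₁) * (1 - g₂) * (1 - g₄) * ((g₁ + g₂ + g₃ + g₄) - 2) + (1 - g₁) * (1 - g₃) * (1 - g₄) * ((g₁ + g₂ + g₃ + g₄) - 2) + (1 - g₂) * (1 - g₃) * (1 - g₄) * ((g₁ + g₂ + g₃ + g₄) - 2))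
        + ((1 : ℝ) / 2) * ((1 - g₃) * g₄ * (g₁ - g₂) ^ 2 + g₃ * (1 - g₄) * (g₁ - g₂) ^ 2 + (1 - g₂) * g₄ * (g₁ - g₃) ^ 2 + (1 - g₂) * g₃ * (g₁ - g₄) ^ 2 + g₂ * (1 - g₄) * (g₁ - g₃) ^ 2 + g₂ * (1 - g₃) * (g₁ - g₄) ^ 2 + (1 - g₁) * g₄ * (g₂ - g₃) ^ 2 + (1 - g₁) * g₃ * (g₂ - g₄) ^ 2 + (1 - g₁) * g₂ * (g₃ - g₄) ^ 2 + g₁ * (1 - g₄) * (g₂ - g₃) ^ 2 + g₁ * (1 - g₃) * (g₂ - g₄) ^ 2 + g₁ * (1 - g₂) * (g₃ - g₄) ^ 2)) := by ring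
  rw [← sub_nonneg, key]
  have hu1 : 0 ≤ 1 - g₁ := by linarith
  have hu2 : 0 ≤ 1 - g₂ := by linarith
  have hu3 : 0 ≤ 1 - g₃ := by linarith
  have hu4 : 0 ≤ 1 - g₄ := by linarith
  have hr4 : 0 ≤ (8 / 3 - (g₁ + g₂ + g₃ + g₄)) := by linarith
  have hr3 : 0 ≤ ((g₁ + g₂ + g₃ + g₄) - 2) := by linarith
  exact mul_nonneg (by positivity) (add_nonneg (add_nonneg (add_nonneg (mul_nonneg (by norm_num) (mul_nonneg (mul_nonneg (mul_nonneg hu1 hu2) hu3) hu4)) (mul_nonneg (by norm_num) (mul_nonneg (mul_nonneg (mul_nonneg (mul_nonneg hu1 hu2) hu3) hu4) hr4))) (mul_nonneg (by norm_num) (add_nonneg (add_nonneg (add_nonneg (mul_nonneg (mul_nonneg (mul_nonneg hu1 hu2) hu3) hr3) (mul_nonneg (mul_nonneg (mul_nonneg hu1 hu2) hu4) hr3)) (mul_nonneg (mul_nonneg (mul_nonneg hu1 hu3) hu4) hr3)) (mul_nonneg (mul_nonneg (mul_nonneg hu2 hu3) hu4) hr3)))) (mul_nonneg (by norm_num) (add_nonneg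 (add_nonneg (add_nonneg (add_nonneg (add_nonneg (add_nonneg (add_nonneg (add_nonneg (add_nonneg (add_nonneg (add_nonneg (mul_nonneg (mul_nonneg hu3 h40) (sq_nonneg (g₁ - g₂))) (mul_nonneg (mul_nonneg h30 hu4) (sq_nonneg (g₁ - g₂)))) (mul_nonneg (mul_nonneg hu2 h40) (sq_nonneg (g₁ - g₃)))) (mul_nonneg (mul_nonneg hu2 h30) (sq_nonneg (g₁ - g₄)))) (mul_nonneg (mul_nonneg h20 hu4) (sq_nonneg (g₁ - g₃)))) (mul_nonneg (mul_nonneg h20 hu3) (sq_nonneg (g₁ - g₄)))) (mul_nonneg (mul_nonneg hu1 h40) (sq_nonneg (g₂ - g₃)))) (mul_nonneg (mul_nonneg hu1 h30) (sq_nonneg (g₂ - g₄)))) (mul_nonneg (mul_nonneg hu1 h20) (sq_nonneg (g₃ - g₄)))) (mul_nonneg (mul_nonneg h10 hu4) (sq_nonneg (g₂ - g₃)))) (mul_nonneg (mul_nonneg h10 hu3) (sq_nonneg (g₂ - g₄)))) (mul_nonneg (mul_nonneg h10 hu2) (sq_nonneg (g₃ - g₄))))))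

/-- **capacity `hZ` of `heavy_fiveAtoms_r3lo/r3hi` for four arbitrary gates (regime `2 ≤ s ≤ 3`)**.  `uᵢ = 1 − gᵢ`; the certificate (12 S₄-symmetric terms, 51 products) is an exact LP solution over symmetrised products of the
nonnegative factors; `ring` checks the identity. [this work] -/
theorem fourGates_capacity_Z {g₁ g₂ g₃ g₄ : ℝ} (h10 : 0 ≤ g₁) (h11 : g₁ ≤ 1) (h20 : 0 ≤ g₂) (h21 : g₂ ≤ 1) (h30 : 0 ≤ g₃) (h31 : g₃ ≤ 1) (h40 : 0 ≤ g₄) (h41 : g₄ ≤ 1) (hs3' : g₁ + g₂ + g₃ + g₄ ≤ 3) (hs2 : 2 ≤ g₁ + g₂ + g₃ + g₄) :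
    (g₁ + g₂ + g₃ + g₄) * ((g₁ + g₂ + g₃ + g₄) / 4 * ((1 - g₁) * (1 - g₂) * (1 - g₃) * (1 - g₄)) - (1 - (g₁ + g₂ + g₃ + g₄) / 4) * (g₁ * g₂ * g₃ * g₄))
      ≤ (3 - (g₁ + g₂ + g₃ + g₄)) * ((g₁ + g₂ + g₃ + g₄) / 4) * ((1 - g₁) * g₂ * g₃ * g₄ + g₁ * (1 - g₂) * g₃ * g₄ + g₁ * g₂ * (1 - g₃) * g₄ + g₁ * g₂ * g₃ * (1 - g₄)) := by
  have key : (3 - (g₁ + g₂ + g₃ + g₄)) * ((g₁ + g₂ + g₃ + g₄) / 4) * ((1 - g₁) * g₂ * g₃ * g₄ + g₁ * (1 - g₂) * g₃ * g₄ + g₁ * g₂ * (1 - g₃) * g₄ + g₁ * g₂ * g₃ * (1 - g₄)) - (g₁ + g₂ + g₃ + g₄) * ((g₁ + g₂ + g₃ + g₄) / 4 * ((1 - g₁) * (1 - g₂) * (1 - g₃) * (1 - g₄)) - (1 - (g₁ + g₂ + g₃ + g₄) / 4) * (g₁ * g₂ * g₃ * g₄))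
      = ((g₁ + g₂ + g₃ + g₄) / 4) * (((1 : ℝ) / 168) * ((1 - g₁) * g₁ + (1 - g₂) * g₂ + (1 - g₃) * g₃ + (1 - g₄) * g₄)
        + ((15 : ℝ) / 56) * ((1 - g₁) * (1 - g₁) * g₁ + (1 - g₂) * (1 - g₂) * g₂ + (1 - g₃) * (1 - g₃) * g₃ + (1 - g₄) * (1 - g₄) * g₄)
        + ((1 : ℝ) / 21) * ((1 - g₁) * (1 - g₁) * g₁ * g₁ + (1 - g₂) * (1 - g₂) * g₂ * g₂ + (1 - g₃) * (1 - g₃) * g₃ * g₃ + (1 - g₄) * (1 - g₄) * g₄ * g₄)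
        + ((31 : ℝ) / 112) * ((1 - g₁) * g₁ * ((g₁ + g₂ + g₃ + g₄) - 2) + (1 - g₂) * g₂ * ((g₁ + g₂ + g₃ + g₄) - 2) + (1 - g₃) * g₃ * ((g₁ + g₂ + g₃ + g₄) - 2) + (1 - g₄) * g₄ * ((g₁ + g₂ + g₃ + g₄) - 2))
        + ((1 : ℝ) / 28) * ((1 - g₁) * (1 - g₂) * (1 - g₃) * (3 - (g₁ + g₂ + g₃ + g₄)) * (3 - (g₁ + g₂ + g₃ + g₄)) + (1 - g₁) * (1 - g₂) * (1 - g₄) * (3 - (g₁ + g₂ + g₃ + g₄)) * (3 - (g₁ + g₂ + g₃ + g₄)) + (1 - g₁) * (1 - g₃) * (1 - g₄) * (3 - (g₁ + g₂ + g₃ + g₄)) * (3 - (g₁ + g₂ + g₃ + g₄)) + (1 - g₂) * (1 - g₃) * (1 - g₄) * (3 - (g₁ + g₂ + g₃ + g₄)) * (3 - (g₁ + g₂ + g₃ + g₄)))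
        + ((9 : ℝ) / 56) * (g₁ * g₂ * g₃ * (3 - (g₁ + g₂ + g₃ + g₄)) * (3 - (g₁ + g₂ + g₃ + g₄)) + g₁ * g₂ * g₄ * (3 - (g₁ + g₂ + g₃ + g₄)) * (3 - (g₁ + g₂ + g₃ + g₄)) + g₁ * g₃ * g₄ * (3 - (g₁ + g₂ + g₃ + g₄)) * (3 - (g₁ + g₂ + g₃ + g₄)) + g₂ * g₃ * g₄ * (3 - (g₁ + g₂ + g₃ + g₄)) * (3 - (g₁ + g₂ + g₃ + g₄)))
        + ((3 : ℝ) / 14) * ((3 - (g₁ + g₂ + g₃ + g₄)) * ((g₁ + g₂ + g₃ + g₄) - 2))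
        + ((3 : ℝ) / 112) * (g₁ * (3 - (g₁ + g₂ + g₃ + g₄)) * ((g₁ + g₂ + g₃ + g₄) - 2) + g₂ * (3 - (g₁ + g₂ + g₃ + g₄)) * ((g₁ + g₂ + g₃ + g₄) - 2) + g₃ * (3 - (g₁ + g₂ + g₃ + g₄)) * ((g₁ + g₂ + g₃ + g₄) - 2) + g₄ * (3 - (g₁ + g₂ + g₃ + g₄)) * ((g₁ + g₂ + g₃ + g₄) - 2))
        + ((1 : ℝ) / 21) * ((1 - g₁) * g₁ * ((g₁ + g₂ + g₃ + g₄) - 2) * ((g₁ + g₂ + g₃ + g₄) - 2) + (1 - g₂) * g₂ * ((g₁ + g₂ + g₃ + g₄) - 2) * ((g₁ + g₂ + g₃ + g₄) - 2) + (1 - g₃) * g₃ * ((g₁ + g₂ + g₃ + g₄) - 2) * ((g₁ + g₂ + g₃ + g₄) - 2) + (1 - g₄) * g₄ * ((g₁ + g₂ + g₃ + g₄) - 2) * ((g₁ + g₂ + g₃ + g₄) - 2))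
        + ((19 : ℝ) / 168) * ((1 - g₃) * (1 - g₄) * (g₁ - g₂) ^ 2 + (1 - g₂) * (1 - g₄) * (g₁ - g₃) ^ 2 + (1 - g₂) * (1 - g₃) * (g₁ - g₄) ^ 2 + (1 - g₁) * (1 - g₄) * (g₂ - g₃) ^ 2 + (1 - g₁) * (1 - g₃) * (g₂ - g₄) ^ 2 + (1 - g₁) * (1 - g₂) * (g₃ - g₄) ^ 2)
        + ((1 : ℝ) / 42) * (g₁ * g₂ * (g₁ - g₂) ^ 2 + g₁ * g₃ * (g₁ - g₃) ^ 2 + g₁ * g₄ * (g₁ - g₄) ^ 2 + g₂ * g₃ * (g₂ - g₃) ^ 2 + g₂ * g₄ * (g₂ - g₄) ^ 2 + g₃ * g₄ * (g₃ - g₄) ^ 2)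
        + ((1 : ℝ) / 8) * (g₃ * g₄ * (g₁ - g₂) ^ 2 * (3 - (g₁ + g₂ + g₃ + g₄)) + g₂ * g₄ * (g₁ - g₃) ^ 2 * (3 - (g₁ + g₂ + g₃ + g₄)) + g₂ * g₃ * (g₁ - g₄) ^ 2 * (3 - (g₁ + g₂ + g₃ + g₄)) + g₁ * g₄ * (g₂ - g₃) ^ 2 * (3 - (g₁ + g₂ + g₃ + g₄)) + g₁ * g₃ * (g₂ - g₄) ^ 2 * (3 - (g₁ + g₂ + g₃ + g₄)) + g₁ * g₂ * (g₃ - g₄) ^ 2 * (3 - (g₁ + g₂ + g₃ + g₄)))) := by ring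
  rw [← sub_nonneg, key]
  have hu1 : 0 ≤ 1 - g₁ := by linarith
  have hu2 : 0 ≤ 1 - g₂ := by linarith
  have hu3 : 0 ≤ 1 - g₃ := by linarith
  have hu4 : 0 ≤ 1 - g₄ := by linarith
  have hr2 : 0 ≤ (3 - (g₁ + g₂ + g₃ + g₄)) := by linarith
  have hr3 : 0 ≤ ((g₁ + g₂ + g₃ + g₄) - 2) := by linarith
  exact mul_nonneg (by positivity) (add_nonneg (add_nonneg (add_nonneg (add_nonneg (add_nonneg (add_nonneg (add_nonneg (add_nonneg (add_nonneg (add_nonneg (add_nonneg (mul_nonneg (by norm_num) (add_nonneg (add_nonneg (add_nonneg (mul_nonneg hu1 h10) (mul_nonneg hu2 h20)) (mul_nonneg hu3 h30)) (mul_nonneg hu4 h40))) (mul_nonneg (by norm_num) (add_nonneg (add_nonneg (add_nonneg (mul_nonneg (mul_nonneg hu1 hu1) h10) (mul_nonneg (mul_nonneg hu2 hu2) h20)) (mul_nonneg (mul_nonneg hu3 hu3) h30)) (mul_nonneg (mul_nonneg hu4 hu4) h40)))) (mul_nonneg (by norm_num) (add_nonneg (add_nonneg (add_nonneg (mul_nonneg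 (mul_nonneg (mul_nonneg hu1 hu1) h10) h10) (mul_nonneg (mul_nonneg (mul_nonneg hu2 hu2) h20) h20)) (mul_nonneg (mul_nonneg (mul_nonneg hu3 hu3) h30) h30)) (mul_nonneg (mul_nonneg (mul_nonneg hu4 hu4) h40) h40)))) (mul_nonneg (by norm_num) (add_nonneg (add_nonneg (add_nonneg (mul_nonneg (mul_nonneg hu1 h10) hr3) (mul_nonneg (mul_nonneg hu2 h20) hr3)) (mul_nonneg (mul_nonneg hu3 h30) hr3)) (mul_nonneg (mul_nonneg hu4 h40) hr3)))) (mul_nonneg (by norm_num) (add_nonneg (add_nonneg (add_nonneg (mul_nonneg (mul_nonneg (mul_nonneg (mul_nonneg hu1 hu2) hu3) hr2) hr2) (mul_nonneg (mul_nonneg (mul_nonneg (mul_nonneg hu1 hu2) hu4) hr2) hr2)) (mul_nonneg (mul_nonneg (mul_nonneg (mul_nonneg hu1 hu3) hu4) hr2) hr2)) (mul_nonneg (mul_nonneg (mul_nonneg (mul_nonneg hu2 hu3) hu4) hr2) hr2)))) (mul_nonneg (by norm_num) (add_nonneg (add_nonneg (add_nonneg (mul_nonneg (mul_nonneg (mul_nonneg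 (mul_nonneg h10 h20) h30) hr2) hr2) (mul_nonneg (mul_nonneg (mul_nonneg (mul_nonneg h10 h20) h40) hr2) hr2)) (mul_nonneg (mul_nonneg (mul_nonneg (mul_nonneg h10 h30) h40) hr2) hr2)) (mul_nonneg (mul_nonneg (mul_nonneg (mul_nonneg h20 h30) h40) hr2) hr2)))) (mul_nonneg (by norm_num) (mul_nonneg hr2 hr3))) (mul_nonneg (by norm_num) (add_nonneg (add_nonneg (add_nonneg (mul_nonneg (mul_nonneg h10 hr2) hr3) (mul_nonneg (mul_nonneg h20 hr2) hr3)) (mul_nonneg (mul_nonneg h30 hr2) hr3)) (mul_nonneg (mul_nonneg h40 hr2) hr3)))) (mul_nonneg (by norm_num) (add_nonneg (add_nonneg (add_nonneg (mul_nonneg (mul_nonneg (mul_nonneg hu1 h10) hr3) hr3) (mul_nonneg (mul_nonneg (mul_nonneg hu2 h20) hr3) hr3)) (mul_nonneg (mul_nonneg (mul_nonneg hu3 h30) hr3) hr3)) (mul_nonneg (mul_nonneg (mul_nonneg hu4 h40) hr3) hr3)))) (mul_nonneg (by norm_num) (add_nonneg (add_nonneg (add_nonneg (add_nonneg (add_nonneg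 (mul_nonneg (mul_nonneg hu3 hu4) (sq_nonneg (g₁ - g₂))) (mul_nonneg (mul_nonneg hu2 hu4) (sq_nonneg (g₁ - g₃)))) (mul_nonneg (mul_nonneg hu2 hu3) (sq_nonneg (g₁ - g₄)))) (mul_nonneg (mul_nonneg hu1 hu4) (sq_nonneg (g₂ - g₃)))) (mul_nonneg (mul_nonneg hu1 hu3) (sq_nonneg (g₂ - g₄)))) (mul_nonneg (mul_nonneg hu1 hu2) (sq_nonneg (g₃ - g₄)))))) (mul_nonneg (by norm_num) (add_nonneg (add_nonneg (add_nonneg (add_nonneg (add_nonneg (mul_nonneg (mul_nonneg h10 h20) (sq_nonneg (g₁ - g₂))) (mul_nonneg (mul_nonneg h10 h30) (sq_nonneg (g₁ - g₃)))) (mul_nonneg (mul_nonneg h10 h40) (sq_nonneg (g₁ - g₄)))) (mul_nonneg (mul_nonneg h20 h30) (sq_nonneg (g₂ - g₃)))) (mul_nonneg (mul_nonneg h20 h40) (sq_nonneg (g₂ - g₄)))) (mul_nonneg (mul_nonneg h30 h40) (sq_nonneg (g₃ - g₄)))))) (mul_nonneg (by norm_num) (add_nonneg (add_nonneg (add_nonneg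 (add_nonneg (add_nonneg (mul_nonneg (mul_nonneg (mul_nonneg h30 h40) (sq_nonneg (g₁ - g₂))) hr2) (mul_nonneg (mul_nonneg (mul_nonneg h20 h40) (sq_nonneg (g₁ - g₃))) hr2)) (mul_nonneg (mul_nonneg (mul_nonneg h20 h30) (sq_nonneg (g₁ - g₄))) hr2)) (mul_nonneg (mul_nonneg (mul_nonneg h10 h40) (sq_nonneg (g₂ - g₃))) hr2)) (mul_nonneg (mul_nonneg (mul_nonneg h10 h30) (sq_nonneg (g₂ - g₄))) hr2)) (mul_nonneg (mul_nonneg (mul_nonneg h10 h20) (sq_nonneg (g₃ - g₄))) hr2))))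

/-- **capacity `hO` of `heavy_fiveAtoms_r3hi` for four arbitrary gates (regime `8/3 ≤ s ≤ 3`)**.  `uᵢ = 1 − gᵢ`; the certificate (16 S₄-symmetric terms, 74 products) is an exact LP solution over symmetrised products of the
nonnegative factors; `ring` checks the identity. [this work] -/
theorem fourGates_capacity_O {g₁ g₂ g₃ g₄ : ℝ} (h10 : 0 ≤ g₁) (h11 : g₁ ≤ 1) (h20 : 0 ≤ g₂) (h21 : g₂ ≤ 1) (h30 : 0 ≤ g₃) (h31 : g₃ ≤ 1) (h40 : 0 ≤ g₄) (h41 : g₄ ≤ 1) (hs3' : g₁ + g₂ + g₃ + g₄ ≤ 3) (hs83' : 8 / 3 ≤ g₁ + g₂ + g₃ + g₄) :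
    (g₁ + g₂ + g₃ + g₄) / 4 * (((g₁ + g₂ + g₃ + g₄) - 2) * (g₁ * (1 - g₂) * (1 - g₃) * (1 - g₄) + (1 - g₁) * g₂ * (1 - g₃) * (1 - g₄) + (1 - g₁) * (1 - g₂) * g₃ * (1 - g₄) + (1 - g₁) * (1 - g₂) * (1 - g₃) * g₄) - (3 - (g₁ + g₂ + g₃ + g₄)) * (g₁ * g₂ * (1 - g₃) * (1 - g₄) + g₁ * (1 - g₂) * g₃ * (1 - g₄) + g₁ * (1 - g₂) * (1 - g₃) * g₄ + (1 - g₁) * g₂ * g₃ * (1 - g₄) + (1 - g₁) * g₂ * (1 - g₃) * g₄ + (1 - g₁) * (1 - g₂) * g₃ * g₄))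
      ≤ (1 - (g₁ + g₂ + g₃ + g₄) / 4) * ((g₁ + g₂ + g₃ + g₄) - 2) * ((1 - g₁) * g₂ * g₃ * g₄ + g₁ * (1 - g₂) * g₃ * g₄ + g₁ * g₂ * (1 - g₃) * g₄ + g₁ * g₂ * g₃ * (1 - g₄)) := by
  have key : (1 - (g₁ + g₂ + g₃ + g₄) / 4) * ((g₁ + g₂ + g₃ + g₄) - 2) * ((1 - g₁) * g₂ * g₃ * g₄ + g₁ * (1 - g₂) * g₃ * g₄ + g₁ * g₂ * (1 - g₃) * g₄ + g₁ * g₂ * g₃ * (1 - g₄)) - (g₁ + g₂ + g₃ + g₄) / 4 * (((g₁ + g₂ + g₃ + g₄) - 2) * (g₁ * (1 - g₂) * (1 - g₃) * (1 - g₄) + (1 - g₁) * g₂ * (1 - g₃) * (1 - g₄) + (1 - g₁) * (1 - g₂) * g₃ * (1 - g₄) + (1 - g₁) * (1 - g₂) * (1 - g₃) * g₄) - (3 - (g₁ + g₂ + g₃ + g₄)) * (g₁ * g₂ * (1 - g₃) * (1 - g₄) + g₁ * (1 - g₂) * g₃ * (1 - g₄) + g₁ * (1 - g₂) * (1 - g₃)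 * g₄ + (1 - g₁) * g₂ * g₃ * (1 - g₄) + (1 - g₁) * g₂ * (1 - g₃) * g₄ + (1 - g₁) * (1 - g₂) * g₃ * g₄))
      = ((1 : ℝ) / 4) * (((11128 : ℝ) / 74667) * (g₁ * g₁ * g₁ + g₂ * g₂ * g₂ + g₃ * g₃ * g₃ + g₄ * g₄ * g₄)
        + ((1573 : ℝ) / 24889) * ((1 - g₁) * (1 - g₁) * (1 - g₁) * g₁ + (1 - g₂) * (1 - g₂) * (1 - g₂) * g₂ + (1 - g₃) * (1 - g₃) * (1 - g₃) * g₃ + (1 - g₄) * (1 - g₄) * (1 - g₄) * g₄)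
        + ((1368212 : ℝ) / 224001) * ((1 - g₁) * (1 - g₂) * (1 - g₃) * (1 - g₄))
        + ((15739 : ℝ) / 74667) * ((3 - (g₁ + g₂ + g₃ + g₄)))
        + ((47965 : ℝ) / 224001) * (g₁ * g₁ * g₁ * (3 - (g₁ + g₂ + g₃ + g₄)) + g₂ * g₂ * g₂ * (3 - (g₁ + g₂ + g₃ + g₄)) + g₃ * g₃ * g₃ * (3 - (g₁ + g₂ + g₃ + g₄)) + g₄ * g₄ * g₄ * (3 - (g₁ + g₂ + g₃ + g₄)))
        + ((168088 : ℝ) / 74667) * ((1 - g₁) * (1 - g₂) * (1 - g₃) * (1 - g₄) * ((g₁ + g₂ + g₃ + g₄) - 8 / 3))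
        + ((3083 : ℝ) / 74667) * ((3 - (g₁ + g₂ + g₃ + g₄)) * (3 - (g₁ + g₂ + g₃ + g₄)))
        + ((24073 : ℝ) / 224001) * (g₁ * g₁ * (3 - (g₁ + g₂ + g₃ + g₄)) * (3 - (g₁ + g₂ + g₃ + g₄)) + g₂ * g₂ * (3 - (g₁ + g₂ + g₃ + g₄)) * (3 - (g₁ + g₂ + g₃ + g₄)) + g₃ * g₃ * (3 - (g₁ + g₂ + g₃ + g₄)) * (3 - (g₁ + g₂ + g₃ + g₄)) + g₄ * g₄ * (3 - (g₁ + g₂ + g₃ + g₄)) * (3 - (g₁ + g₂ + g₃ + g₄)))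
        + ((1725 : ℝ) / 49778) * ((1 - g₁) * (1 - g₂) * (1 - g₃) * (3 - (g₁ + g₂ + g₃ + g₄)) * ((g₁ + g₂ + g₃ + g₄) - 8 / 3) + (1 - g₁) * (1 - g₂) * (1 - g₄) * (3 - (g₁ + g₂ + g₃ + g₄)) * ((g₁ + g₂ + g₃ + g₄) - 8 / 3) + (1 - g₁) * (1 - g₃) * (1 - g₄) * (3 - (g₁ + g₂ + g₃ + g₄)) * ((g₁ + g₂ + g₃ + g₄) - 8 / 3) + (1 - g₂) * (1 - g₃) * (1 - g₄) * (3 - (g₁ + g₂ + g₃ + g₄)) * ((g₁ + g₂ + g₃ + g₄) - 8 / 3))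
        + ((20957 : ℝ) / 49778) * ((1 - g₁) * (1 - g₂) * (1 - g₃) * g₄ * (3 - (g₁ + g₂ + g₃ + g₄)) * ((g₁ + g₂ + g₃ + g₄) - 8 / 3) + (1 - g₁) * (1 - g₂) * g₃ * (1 - g₄) * (3 - (g₁ + g₂ + g₃ + g₄)) * ((g₁ + g₂ + g₃ + g₄) - 8 / 3) + (1 - g₁) * g₂ * (1 - g₃) * (1 - g₄) * (3 - (g₁ + g₂ + g₃ + g₄)) * ((g₁ + g₂ + g₃ + g₄) - 8 / 3) + g₁ * (1 - g₂) * (1 - g₃) * (1 - g₄) * (3 - (g₁ + g₂ + g₃ + g₄)) * ((g₁ + g₂ + g₃ + g₄) - 8 / 3))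
        + ((1966 : ℝ) / 24889) * ((1 - g₁) * g₂ * g₃ * g₄ * (3 - (g₁ + g₂ + g₃ + g₄)) * ((g₁ + g₂ + g₃ + g₄) - 8 / 3) + g₁ * (1 - g₂) * g₃ * g₄ * (3 - (g₁ + g₂ + g₃ + g₄)) * ((g₁ + g₂ + g₃ + g₄) - 8 / 3) + g₁ * g₂ * (1 - g₃) * g₄ * (3 - (g₁ + g₂ + g₃ + g₄)) * ((g₁ + g₂ + g₃ + g₄) - 8 / 3) + g₁ * g₂ * g₃ * (1 - g₄) * (3 - (g₁ + g₂ + g₃ + g₄)) * ((g₁ + g₂ + g₃ + g₄) - 8 / 3))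
        + ((2037 : ℝ) / 24889) * ((g₁ - g₂) ^ 2 + (g₁ - g₃) ^ 2 + (g₁ - g₄) ^ 2 + (g₂ - g₃) ^ 2 + (g₂ - g₄) ^ 2 + (g₃ - g₄) ^ 2)
        + ((1573 : ℝ) / 49778) * ((1 - g₃) * (1 - g₃) * g₄ * (g₁ - g₂) ^ 2 + g₃ * (1 - g₄) * (1 - g₄) * (g₁ - g₂) ^ 2 + (1 - g₂) * (1 - g₂) * g₄ * (g₁ - g₃) ^ 2 + (1 - g₂) * (1 - g₂) * g₃ * (g₁ - g₄) ^ 2 + g₂ * (1 - g₄) * (1 - g₄) * (g₁ - g₃) ^ 2 + g₂ * (1 - g₃) * (1 - g₃) * (g₁ - g₄) ^ 2 + (1 - g₁) * (1 - g₁) * g₄ * (g₂ - g₃) ^ 2 + (1 - g₁) * (1 - g₁) * g₃ * (g₂ - g₄) ^ 2 + (1 - g₁) * (1 - g₁) * g₂ * (g₃ - g₄) ^ 2 + g₁ * (1 - g₄) * (1 - g₄) * (g₂ - g₃) ^ 2 + g₁ * (1 - g₃) * (1 - g₃) * (g₂ - g₄) ^ 2 + g₁ * (1 - g₂) * (1 -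 g₂) * (g₃ - g₄) ^ 2)
        + ((1573 : ℝ) / 49778) * ((1 - g₃) * g₄ * g₄ * (g₁ - g₂) ^ 2 + g₃ * g₃ * (1 - g₄) * (g₁ - g₂) ^ 2 + (1 - g₂) * g₄ * g₄ * (g₁ - g₃) ^ 2 + (1 - g₂) * g₃ * g₃ * (g₁ - g₄) ^ 2 + g₂ * g₂ * (1 - g₄) * (g₁ - g₃) ^ 2 + g₂ * g₂ * (1 - g₃) * (g₁ - g₄) ^ 2 + (1 - g₁) * g₄ * g₄ * (g₂ - g₃) ^ 2 + (1 - g₁) * g₃ * g₃ * (g₂ - g₄) ^ 2 + (1 - g₁) * g₂ * g₂ * (g₃ - g₄) ^ 2 + g₁ * g₁ * (1 - g₄) * (g₂ - g₃) ^ 2 + g₁ * g₁ * (1 - g₃) * (g₂ - g₄) ^ 2 + g₁ * g₁ * (1 - g₂) * (g₃ - g₄) ^ 2)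
        + ((7650 : ℝ) / 24889) * (g₃ * g₄ * (g₁ - g₂) ^ 2 * ((g₁ + g₂ + g₃ + g₄) - 8 / 3) + g₂ * g₄ * (g₁ - g₃) ^ 2 * ((g₁ + g₂ + g₃ + g₄) - 8 / 3) + g₂ * g₃ * (g₁ - g₄) ^ 2 * ((g₁ + g₂ + g₃ + g₄) - 8 / 3) + g₁ * g₄ * (g₂ - g₃) ^ 2 * ((g₁ + g₂ + g₃ + g₄) - 8 / 3) + g₁ * g₃ * (g₂ - g₄) ^ 2 * ((g₁ + g₂ + g₃ + g₄) - 8 / 3) + g₁ * g₂ * (g₃ - g₄) ^ 2 * ((g₁ + g₂ + g₃ + g₄) - 8 / 3))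
        + ((12683 : ℝ) / 224001) * ((g₁ - g₂) ^ 2 * (3 - (g₁ + g₂ + g₃ + g₄)) * (3 - (g₁ + g₂ + g₃ + g₄)) + (g₁ - g₃) ^ 2 * (3 - (g₁ + g₂ + g₃ + g₄)) * (3 - (g₁ + g₂ + g₃ + g₄)) + (g₁ - g₄) ^ 2 * (3 - (g₁ + g₂ + g₃ + g₄)) * (3 - (g₁ + g₂ + g₃ + g₄)) + (g₂ - g₃) ^ 2 * (3 - (g₁ + g₂ + g₃ + g₄)) * (3 - (g₁ + g₂ + g₃ + g₄)) + (g₂ - g₄) ^ 2 * (3 - (g₁ + g₂ + g₃ + g₄)) * (3 - (g₁ + g₂ + g₃ + g₄)) + (g₃ - g₄) ^ 2 * (3 - (g₁ + g₂ + g₃ + g₄)) * (3 - (g₁ + g₂ + g₃ + g₄)))) := by ring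
  rw [← sub_nonneg, key]
  have hu1 : 0 ≤ 1 - g₁ := by linarith
  have hu2 : 0 ≤ 1 - g₂ := by linarith
  have hu3 : 0 ≤ 1 - g₃ := by linarith
  have hu4 : 0 ≤ 1 - g₄ := by linarith
  have hr2 : 0 ≤ (3 - (g₁ + g₂ + g₃ + g₄)) := by linarith
  have hr5 : 0 ≤ ((g₁ + g₂ + g₃ + g₄) - 8 / 3) := by linarith
  exact mul_nonneg (by positivity) (add_nonneg (add_nonneg (add_nonneg (add_nonneg (add_nonneg (add_nonneg (add_nonneg (add_nonneg (add_nonneg (add_nonneg (add_nonneg (add_nonneg (add_nonneg (add_nonneg (add_nonneg (mul_nonneg (by norm_num) (add_nonneg (add_nonneg (add_nonneg (mul_nonneg (mul_nonneg h10 h10) h10) (mul_nonneg (mul_nonneg h20 h20) h20)) (mul_nonneg (mul_nonneg h30 h30) h30)) (mul_nonneg (mul_nonneg h40 h40) h40))) (mul_nonneg (by norm_num) (add_nonneg (add_nonneg (add_nonneg (mul_nonneg (mul_nonneg (mul_nonneg hu1 hu1) hu1) h10) (mul_nonneg (mul_nonneg (mul_nonneg hu2 hu2) hu2) h20)) (mul_nonneg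 (mul_nonneg (mul_nonneg hu3 hu3) hu3) h30)) (mul_nonneg (mul_nonneg (mul_nonneg hu4 hu4) hu4) h40)))) (mul_nonneg (by norm_num) (mul_nonneg (mul_nonneg (mul_nonneg hu1 hu2) hu3) hu4))) (mul_nonneg (by norm_num) hr2)) (mul_nonneg (by norm_num) (add_nonneg (add_nonneg (add_nonneg (mul_nonneg (mul_nonneg (mul_nonneg h10 h10) h10) hr2) (mul_nonneg (mul_nonneg (mul_nonneg h20 h20) h20) hr2)) (mul_nonneg (mul_nonneg (mul_nonneg h30 h30) h30) hr2)) (mul_nonneg (mul_nonneg (mul_nonneg h40 h40) h40) hr2)))) (mul_nonneg (by norm_num) (mul_nonneg (mul_nonneg (mul_nonneg (mul_nonneg hu1 hu2) hu3) hu4) hr5))) (mul_nonneg (by norm_num) (mul_nonneg hr2 hr2))) (mul_nonneg (by norm_num) (add_nonneg (add_nonneg (add_nonneg (mul_nonneg (mul_nonneg (mul_nonneg h10 h10) hr2) hr2) (mul_nonneg (mul_nonneg (mul_nonneg h20 h20) hr2) hr2)) (mul_nonneg (mul_nonneg (mul_nonneg h30 h30) hr2) hr2)) (mul_nonneg (mul_nonneg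 (mul_nonneg h40 h40) hr2) hr2)))) (mul_nonneg (by norm_num) (add_nonneg (add_nonneg (add_nonneg (mul_nonneg (mul_nonneg (mul_nonneg (mul_nonneg hu1 hu2) hu3) hr2) hr5) (mul_nonneg (mul_nonneg (mul_nonneg (mul_nonneg hu1 hu2) hu4) hr2) hr5)) (mul_nonneg (mul_nonneg (mul_nonneg (mul_nonneg hu1 hu3) hu4) hr2) hr5)) (mul_nonneg (mul_nonneg (mul_nonneg (mul_nonneg hu2 hu3) hu4) hr2) hr5)))) (mul_nonneg (by norm_num) (add_nonneg (add_nonneg (add_nonneg (mul_nonneg (mul_nonneg (mul_nonneg (mul_nonneg (mul_nonneg hu1 hu2) hu3) h40) hr2) hr5) (mul_nonneg (mul_nonneg (mul_nonneg (mul_nonneg (mul_nonneg hu1 hu2) h30) hu4) hr2) hr5)) (mul_nonneg (mul_nonneg (mul_nonneg (mul_nonneg (mul_nonneg hu1 h20) hu3) hu4) hr2) hr5)) (mul_nonneg (mul_nonneg (mul_nonneg (mul_nonneg (mul_nonneg h10 hu2) hu3) hu4) hr2) hr5)))) (mul_nonneg (by norm_num) (add_nonneg (add_nonneg (add_nonneg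 (mul_nonneg (mul_nonneg (mul_nonneg (mul_nonneg (mul_nonneg hu1 h20) h30) h40) hr2) hr5) (mul_nonneg (mul_nonneg (mul_nonneg (mul_nonneg (mul_nonneg h10 hu2) h30) h40) hr2) hr5)) (mul_nonneg (mul_nonneg (mul_nonneg (mul_nonneg (mul_nonneg h10 h20) hu3) h40) hr2) hr5)) (mul_nonneg (mul_nonneg (mul_nonneg (mul_nonneg (mul_nonneg h10 h20) h30) hu4) hr2) hr5)))) (mul_nonneg (by norm_num) (add_nonneg (add_nonneg (add_nonneg (add_nonneg (add_nonneg (sq_nonneg (g₁ - g₂)) (sq_nonneg (g₁ - g₃))) (sq_nonneg (g₁ - g₄))) (sq_nonneg (g₂ - g₃))) (sq_nonneg (g₂ - g₄))) (sq_nonneg (g₃ - g₄))))) (mul_nonneg (by norm_num) (add_nonneg (add_nonneg (add_nonneg (add_nonneg (add_nonneg (add_nonneg (add_nonneg (add_nonneg (add_nonneg (add_nonneg (add_nonneg (mul_nonneg (mul_nonneg (mul_nonneg hu3 hu3) h40) (sq_nonneg (g₁ - g₂))) (mul_nonneg (mul_nonneg (mul_nonneg h30 hu4) hu4) (sq_nonneg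 (g₁ - g₂)))) (mul_nonneg (mul_nonneg (mul_nonneg hu2 hu2) h40) (sq_nonneg (g₁ - g₃)))) (mul_nonneg (mul_nonneg (mul_nonneg hu2 hu2) h30) (sq_nonneg (g₁ - g₄)))) (mul_nonneg (mul_nonneg (mul_nonneg h20 hu4) hu4) (sq_nonneg (g₁ - g₃)))) (mul_nonneg (mul_nonneg (mul_nonneg h20 hu3) hu3) (sq_nonneg (g₁ - g₄)))) (mul_nonneg (mul_nonneg (mul_nonneg hu1 hu1) h40) (sq_nonneg (g₂ - g₃)))) (mul_nonneg (mul_nonneg (mul_nonneg hu1 hu1) h30) (sq_nonneg (g₂ - g₄)))) (mul_nonneg (mul_nonneg (mul_nonneg hu1 hu1) h20) (sq_nonneg (g₃ - g₄)))) (mul_nonneg (mul_nonneg (mul_nonneg h10 hu4) hu4) (sq_nonneg (g₂ - g₃)))) (mul_nonneg (mul_nonneg (mul_nonneg h10 hu3) hu3) (sq_nonneg (g₂ - g₄)))) (mul_nonneg (mul_nonneg (mul_nonneg h10 hu2) hu2) (sq_nonneg (g₃ - g₄)))))) (mul_nonneg (by norm_num) (add_nonneg (add_nonneg (add_nonneg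 (add_nonneg (add_nonneg (add_nonneg (add_nonneg (add_nonneg (add_nonneg (add_nonneg (add_nonneg (mul_nonneg (mul_nonneg (mul_nonneg hu3 h40) h40) (sq_nonneg (g₁ - g₂))) (mul_nonneg (mul_nonneg (mul_nonneg h30 h30) hu4) (sq_nonneg (g₁ - g₂)))) (mul_nonneg (mul_nonneg (mul_nonneg hu2 h40) h40) (sq_nonneg (g₁ - g₃)))) (mul_nonneg (mul_nonneg (mul_nonneg hu2 h30) h30) (sq_nonneg (g₁ - g₄)))) (mul_nonneg (mul_nonneg (mul_nonneg h20 h20) hu4) (sq_nonneg (g₁ - g₃)))) (mul_nonneg (mul_nonneg (mul_nonneg h20 h20) hu3) (sq_nonneg (g₁ - g₄)))) (mul_nonneg (mul_nonneg (mul_nonneg hu1 h40) h40) (sq_nonneg (g₂ - g₃)))) (mul_nonneg (mul_nonneg (mul_nonneg hu1 h30) h30) (sq_nonneg (g₂ - g₄)))) (mul_nonneg (mul_nonneg (mul_nonneg hu1 h20) h20) (sq_nonneg (g₃ - g₄)))) (mul_nonneg (mul_nonneg (mul_nonneg h10 h10) hu4) (sq_nonneg (g₂ - g₃)))) (mul_nonneg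 (mul_nonneg (mul_nonneg h10 h10) hu3) (sq_nonneg (g₂ - g₄)))) (mul_nonneg (mul_nonneg (mul_nonneg h10 h10) hu2) (sq_nonneg (g₃ - g₄)))))) (mul_nonneg (by norm_num) (add_nonneg (add_nonneg (add_nonneg (add_nonneg (add_nonneg (mul_nonneg (mul_nonneg (mul_nonneg h30 h40) (sq_nonneg (g₁ - g₂))) hr5) (mul_nonneg (mul_nonneg (mul_nonneg h20 h40) (sq_nonneg (g₁ - g₃))) hr5)) (mul_nonneg (mul_nonneg (mul_nonneg h20 h30) (sq_nonneg (g₁ - g₄))) hr5)) (mul_nonneg (mul_nonneg (mul_nonneg h10 h40) (sq_nonneg (g₂ - g₃))) hr5)) (mul_nonneg (mul_nonneg (mul_nonneg h10 h30) (sq_nonneg (g₂ - g₄))) hr5)) (mul_nonneg (mul_nonneg (mul_nonneg h10 h20) (sq_nonneg (g₃ - g₄))) hr5)))) (mul_nonneg (by norm_num) (add_nonneg (add_nonneg (add_nonneg (add_nonneg (add_nonneg (mul_nonneg (mul_nonneg (sq_nonneg (g₁ - g₂)) hr2) hr2) (mul_nonneg (mul_nonneg (sq_nonneg (g₁ - g₃))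 hr2) hr2)) (mul_nonneg (mul_nonneg (sq_nonneg (g₁ - g₄)) hr2) hr2)) (mul_nonneg (mul_nonneg (sq_nonneg (g₂ - g₃)) hr2) hr2)) (mul_nonneg (mul_nonneg (sq_nonneg (g₂ - g₄)) hr2) hr2)) (mul_nonneg (mul_nonneg (sq_nonneg (g₃ - g₄)) hr2) hr2))))

set_option maxHeartbeats 400000 in
/-- **separator of `heavy_fiveAtoms_r3hi` for four arbitrary gates, case `p₄ ≤ 3p₀` (regime `8/3 ≤ s ≤ 3`): then `(s−2)·p₁ ≤ (3−s)·p₂` ('one fits')**.  `uᵢ = 1 − gᵢ`; the certificate (16 S₄-symmetric terms, 87 products) is an exact LP solution over symmetrised products of the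
nonnegative factors; `ring` checks the identity. [this work] -/
theorem fourGates_capacity_Sep {g₁ g₂ g₃ g₄ : ℝ} (h10 : 0 ≤ g₁) (h11 : g₁ ≤ 1) (h20 : 0 ≤ g₂) (h21 : g₂ ≤ 1) (h30 : 0 ≤ g₃) (h31 : g₃ ≤ 1) (h40 : 0 ≤ g₄) (h41 : g₄ ≤ 1) (hs3' : g₁ + g₂ + g₃ + g₄ ≤ 3) (hs83' : 8 / 3 ≤ g₁ + g₂ + g₃ + g₄) (hsig0 : (g₁ * g₂ * g₃ * g₄) ≤ 3 * ((1 - g₁) * (1 - g₂) * (1 - g₃) * (1 - g₄))) :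
    ((g₁ + g₂ + g₃ + g₄) - 2) * (g₁ * (1 - g₂) * (1 - g₃) * (1 - g₄) + (1 - g₁) * g₂ * (1 - g₃) * (1 - g₄) + (1 - g₁) * (1 - g₂) * g₃ * (1 - g₄) + (1 - g₁) * (1 - g₂) * (1 - g₃) * g₄)
      ≤ (3 - (g₁ + g₂ + g₃ + g₄)) * (g₁ * g₂ * (1 - g₃) * (1 - g₄) + g₁ * (1 - g₂) * g₃ * (1 - g₄) + g₁ * (1 - g₂) * (1 - g₃) * g₄ + (1 - g₁) * g₂ * g₃ * (1 - g₄) + (1 - g₁) * g₂ * (1 - g₃) * g₄ + (1 - g₁) * (1 - g₂) * g₃ * g₄) := by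
  have key : (3 - (g₁ + g₂ + g₃ + g₄)) * (g₁ * g₂ * (1 - g₃) * (1 - g₄) + g₁ * (1 - g₂) * g₃ * (1 - g₄) + g₁ * (1 - g₂) * (1 - g₃) * g₄ + (1 - g₁) * g₂ * g₃ * (1 - g₄) + (1 - g₁) * g₂ * (1 - g₃) * g₄ + (1 - g₁) * (1 - g₂) * g₃ * g₄) - ((g₁ + g₂ + g₃ + g₄) - 2) * (g₁ * (1 - g₂) * (1 - g₃) * (1 - g₄) + (1 - g₁) * g₂ * (1 - g₃) * (1 - g₄) + (1 - g₁) * (1 - g₂) * g₃ * (1 - g₄) + (1 - g₁) * (1 - g₂) * (1 - g₃) * g₄)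
      = (1 : ℝ) * (((23 : ℝ) / 147) * ((1 - g₁) * (1 - g₁) * (1 - g₁) * g₁ + (1 - g₂) * (1 - g₂) * (1 - g₂) * g₂ + (1 - g₃) * (1 - g₃) * (1 - g₃) * g₃ + (1 - g₄) * (1 - g₄) * (1 - g₄) * g₄)
        + ((15 : ℝ) / 49) * ((1 - g₁) * (1 - g₂) * (1 - g₃) * (1 - g₄))
        + ((1 : ℝ) / 49) * ((1 - g₁) * (1 - g₁) * (1 - g₁) * (1 - g₁) * g₁ + (1 - g₂) * (1 - g₂) * (1 - g₂) * (1 - g₂) * g₂ + (1 - g₃) * (1 - g₃) * (1 - g₃) * (1 - g₃) * g₃ + (1 - g₄) * (1 - g₄) * (1 - g₄) * (1 - g₄) * g₄)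
        + ((85 : ℝ) / 147) * ((1 - g₁) * (1 - g₂) * (1 - g₃) * (1 - g₄) * (3 - (g₁ + g₂ + g₃ + g₄)))
        + ((13 : ℝ) / 882) * ((1 - g₁) * (1 - g₂) * g₃ * g₄ * (3 - (g₁ + g₂ + g₃ + g₄)) + (1 - g₁) * g₂ * (1 - g₃) * g₄ * (3 - (g₁ + g₂ + g₃ + g₄)) + (1 - g₁) * g₂ * g₃ * (1 - g₄) * (3 - (g₁ + g₂ + g₃ + g₄)) + g₁ * (1 - g₂) * (1 - g₃) * g₄ * (3 - (g₁ + g₂ + g₃ + g₄)) + g₁ * (1 - g₂) * g₃ * (1 - g₄) * (3 - (g₁ + g₂ + g₃ + g₄)) + g₁ * g₂ * (1 - g₃) * (1 - g₄) * (3 - (g₁ + g₂ + g₃ + g₄)))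
        + ((1 : ℝ) / 49) * ((1 - g₁) * (1 - g₁) * (1 - g₁) * g₁ * ((g₁ + g₂ + g₃ + g₄) - 8 / 3) + (1 - g₂) * (1 - g₂) * (1 - g₂) * g₂ * ((g₁ + g₂ + g₃ + g₄) - 8 / 3) + (1 - g₃) * (1 - g₃) * (1 - g₃) * g₃ * ((g₁ + g₂ + g₃ + g₄) - 8 / 3) + (1 - g₄) * (1 - g₄) * (1 - g₄) * g₄ * ((g₁ + g₂ + g₃ + g₄) - 8 / 3))
        + ((157 : ℝ) / 882) * ((3 * ((1 - g₁) * (1 - g₂) * (1 - g₃) * (1 - g₄)) - (g₁ * g₂ * g₃ * g₄)))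
        + ((59 : ℝ) / 294) * ((3 - (g₁ + g₂ + g₃ + g₄)) * (3 - (g₁ + g₂ + g₃ + g₄)))
        + ((5 : ℝ) / 49) * ((1 - g₁) * g₁ * (3 - (g₁ + g₂ + g₃ + g₄)) * (3 - (g₁ + g₂ + g₃ + g₄)) + (1 - g₂) * g₂ * (3 - (g₁ + g₂ + g₃ + g₄)) * (3 - (g₁ + g₂ + g₃ + g₄)) + (1 - g₃) * g₃ * (3 - (g₁ + g₂ + g₃ + g₄)) * (3 - (g₁ + g₂ + g₃ + g₄)) + (1 - g₄) * g₄ * (3 - (g₁ + g₂ + g₃ + g₄)) * (3 - (g₁ + g₂ + g₃ + g₄)))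
        + ((4 : ℝ) / 147) * ((1 - g₁) * g₂ * g₃ * (3 - (g₁ + g₂ + g₃ + g₄)) * (3 - (g₁ + g₂ + g₃ + g₄)) + (1 - g₁) * g₂ * g₄ * (3 - (g₁ + g₂ + g₃ + g₄)) * (3 - (g₁ + g₂ + g₃ + g₄)) + (1 - g₁) * g₃ * g₄ * (3 - (g₁ + g₂ + g₃ + g₄)) * (3 - (g₁ + g₂ + g₃ + g₄)) + g₁ * (1 - g₂) * g₃ * (3 - (g₁ + g₂ + g₃ + g₄)) * (3 - (g₁ + g₂ + g₃ + g₄)) + g₁ * (1 - g₂) * g₄ * (3 - (g₁ + g₂ + g₃ + g₄)) * (3 - (g₁ + g₂ + g₃ + g₄)) + g₁ * g₂ * (1 - g₃) * (3 - (g₁ + g₂ + g₃ + g₄)) * (3 - (g₁ + g₂ + g₃ + g₄)) + g₁ * g₂ * (1 - g₄) * (3 - (g₁ + g₂ + g₃ + g₄)) * (3 - (g₁ + g₂ + g₃ + g₄)) + g₁ * (1 - g₃) * g₄ * (3 - (g₁ + g₂ + g₃ + g₄)) * (3 - (g₁ + g₂ + g₃ + g₄)) + g₁ * g₃ * (1 -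 g₄) * (3 - (g₁ + g₂ + g₃ + g₄)) * (3 - (g₁ + g₂ + g₃ + g₄)) + (1 - g₂) * g₃ * g₄ * (3 - (g₁ + g₂ + g₃ + g₄)) * (3 - (g₁ + g₂ + g₃ + g₄)) + g₂ * (1 - g₃) * g₄ * (3 - (g₁ + g₂ + g₃ + g₄)) * (3 - (g₁ + g₂ + g₃ + g₄)) + g₂ * g₃ * (1 - g₄) * (3 - (g₁ + g₂ + g₃ + g₄)) * (3 - (g₁ + g₂ + g₃ + g₄)))
        + ((13 : ℝ) / 147) * ((1 - g₁) * (1 - g₂) * (3 - (g₁ + g₂ + g₃ + g₄)) * ((g₁ + g₂ + g₃ + g₄) - 8 / 3) + (1 - g₁) * (1 - g₃) * (3 - (g₁ + g₂ + g₃ + g₄)) * ((g₁ + g₂ + g₃ + g₄) - 8 / 3) + (1 - g₁) * (1 - g₄) * (3 - (g₁ + g₂ + g₃ + g₄)) * ((g₁ + g₂ + g₃ + g₄) - 8 / 3) + (1 - g₂) * (1 - g₃) * (3 - (g₁ + g₂ + g₃ + g₄)) * ((g₁ + g₂ + g₃ + g₄) - 8 / 3) + (1 - g₂) * (1 - g₄)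 * (3 - (g₁ + g₂ + g₃ + g₄)) * ((g₁ + g₂ + g₃ + g₄) - 8 / 3) + (1 - g₃) * (1 - g₄) * (3 - (g₁ + g₂ + g₃ + g₄)) * ((g₁ + g₂ + g₃ + g₄) - 8 / 3))
        + ((5 : ℝ) / 294) * (((g₁ + g₂ + g₃ + g₄) - 8 / 3) * (3 * ((1 - g₁) * (1 - g₂) * (1 - g₃) * (1 - g₄)) - (g₁ * g₂ * g₃ * g₄)))
        + ((3 : ℝ) / 98) * ((1 - g₃) * (1 - g₃) * (1 - g₃) * (g₁ - g₂) ^ 2 + (1 - g₄) * (1 - g₄) * (1 - g₄) * (g₁ - g₂) ^ 2 + (1 - g₂) * (1 - g₂) * (1 - g₂) * (g₁ - g₃) ^ 2 + (1 - g₂) * (1 - g₂) * (1 - g₂) * (g₁ - g₄) ^ 2 + (1 - g₄) * (1 - g₄) * (1 - g₄) * (g₁ - g₃) ^ 2 + (1 - g₃) * (1 - g₃) * (1 - g₃) * (g₁ - g₄) ^ 2 + (1 - g₁) * (1 - g₁) * (1 - g₁) * (g₂ - g₃) ^ 2 + (1 - g₁) * (1 - g₁) * (1 - g₁) * (g₂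 - g₄) ^ 2 + (1 - g₁) * (1 - g₁) * (1 - g₁) * (g₃ - g₄) ^ 2 + (1 - g₄) * (1 - g₄) * (1 - g₄) * (g₂ - g₃) ^ 2 + (1 - g₃) * (1 - g₃) * (1 - g₃) * (g₂ - g₄) ^ 2 + (1 - g₂) * (1 - g₂) * (1 - g₂) * (g₃ - g₄) ^ 2)
        + ((4 : ℝ) / 49) * ((1 - g₃) * (1 - g₃) * g₄ * (g₁ - g₂) ^ 2 + g₃ * (1 - g₄) * (1 - g₄) * (g₁ - g₂) ^ 2 + (1 - g₂) * (1 - g₂) * g₄ * (g₁ - g₃) ^ 2 + (1 - g₂) * (1 - g₂) * g₃ * (g₁ - g₄) ^ 2 + g₂ * (1 - g₄) * (1 - g₄) * (g₁ - g₃) ^ 2 + g₂ * (1 - g₃) * (1 - g₃) * (g₁ - g₄) ^ 2 + (1 - g₁) * (1 - g₁) * g₄ * (g₂ - g₃) ^ 2 + (1 - g₁) * (1 - g₁) * g₃ * (g₂ - g₄) ^ 2 + (1 - g₁) * (1 - g₁) * g₂ * (g₃ - g₄) ^ 2 + g₁ * (1 - g₄) * (1 - g₄) * (g₂ - g₃)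 ^ 2 + g₁ * (1 - g₃) * (1 - g₃) * (g₂ - g₄) ^ 2 + g₁ * (1 - g₂) * (1 - g₂) * (g₃ - g₄) ^ 2)
        + ((11 : ℝ) / 147) * ((g₁ - g₂) ^ 2 * (3 - (g₁ + g₂ + g₃ + g₄)) * (3 - (g₁ + g₂ + g₃ + g₄)) + (g₁ - g₃) ^ 2 * (3 - (g₁ + g₂ + g₃ + g₄)) * (3 - (g₁ + g₂ + g₃ + g₄)) + (g₁ - g₄) ^ 2 * (3 - (g₁ + g₂ + g₃ + g₄)) * (3 - (g₁ + g₂ + g₃ + g₄)) + (g₂ - g₃) ^ 2 * (3 - (g₁ + g₂ + g₃ + g₄)) * (3 - (g₁ + g₂ + g₃ + g₄)) + (g₂ - g₄) ^ 2 * (3 - (g₁ + g₂ + g₃ + g₄)) * (3 - (g₁ + g₂ + g₃ + g₄)) + (g₃ - g₄) ^ 2 * (3 - (g₁ + g₂ + g₃ + g₄)) * (3 - (g₁ + g₂ + g₃ + g₄)))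
        + ((1 : ℝ) / 98) * (g₃ * (g₁ - g₂) ^ 2 * (3 - (g₁ + g₂ + g₃ + g₄)) * (3 - (g₁ + g₂ + g₃ + g₄)) + g₄ * (g₁ - g₂) ^ 2 * (3 - (g₁ + g₂ + g₃ + g₄)) * (3 - (g₁ + g₂ + g₃ + g₄)) + g₂ * (g₁ - g₃) ^ 2 * (3 - (g₁ + g₂ + g₃ + g₄)) * (3 - (g₁ + g₂ + g₃ + g₄)) + g₂ * (g₁ - g₄) ^ 2 * (3 - (g₁ + g₂ + g₃ + g₄)) * (3 - (g₁ + g₂ + g₃ + g₄)) + g₄ * (g₁ - g₃) ^ 2 * (3 - (g₁ + g₂ + g₃ + g₄)) * (3 - (g₁ + g₂ + g₃ + g₄)) + g₃ * (g₁ - g₄) ^ 2 * (3 - (g₁ + g₂ + g₃ + g₄)) * (3 - (g₁ + g₂ + g₃ + g₄)) + g₁ * (g₂ - g₃) ^ 2 * (3 - (g₁ + g₂ + g₃ + g₄)) * (3 - (g₁ + g₂ + g₃ + g₄)) + g₁ * (g₂ - g₄) ^ 2 * (3 - (g₁ + g₂ + g₃ + g₄)) * (3 - (g₁ + g₂ +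 g₃ + g₄)) + g₁ * (g₃ - g₄) ^ 2 * (3 - (g₁ + g₂ + g₃ + g₄)) * (3 - (g₁ + g₂ + g₃ + g₄)) + g₄ * (g₂ - g₃) ^ 2 * (3 - (g₁ + g₂ + g₃ + g₄)) * (3 - (g₁ + g₂ + g₃ + g₄)) + g₃ * (g₂ - g₄) ^ 2 * (3 - (g₁ + g₂ + g₃ + g₄)) * (3 - (g₁ + g₂ + g₃ + g₄)) + g₂ * (g₃ - g₄) ^ 2 * (3 - (g₁ + g₂ + g₃ + g₄)) * (3 - (g₁ + g₂ + g₃ + g₄)))) := by ring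
  rw [← sub_nonneg, key]
  have hu1 : 0 ≤ 1 - g₁ := by linarith
  have hu2 : 0 ≤ 1 - g₂ := by linarith
  have hu3 : 0 ≤ 1 - g₃ := by linarith
  have hu4 : 0 ≤ 1 - g₄ := by linarith
  have hr2 : 0 ≤ (3 - (g₁ + g₂ + g₃ + g₄)) := by linarith
  have hr5 : 0 ≤ ((g₁ + g₂ + g₃ + g₄) - 8 / 3) := by linarith
  have hsig : 0 ≤ (3 * ((1 - g₁) * (1 - g₂) * (1 - g₃) * (1 - g₄)) - (g₁ * g₂ * g₃ * g₄)) := by linarith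
  exact mul_nonneg (by positivity) (add_nonneg (add_nonneg (add_nonneg (add_nonneg (add_nonneg (add_nonneg (add_nonneg (add_nonneg (add_nonneg (add_nonneg (add_nonneg (add_nonneg (add_nonneg (add_nonneg (add_nonneg (mul_nonneg (by norm_num) (add_nonneg (add_nonneg (add_nonneg (mul_nonneg (mul_nonneg (mul_nonneg hu1 hu1) hu1) h10) (mul_nonneg (mul_nonneg (mul_nonneg hu2 hu2) hu2) h20)) (mul_nonneg (mul_nonneg (mul_nonneg hu3 hu3) hu3) h30)) (mul_nonneg (mul_nonneg (mul_nonneg hu4 hu4) hu4) h40))) (mul_nonneg (by norm_num) (mul_nonneg (mul_nonneg (mul_nonneg hu1 hu2) hu3) hu4))) (mul_nonneg (by norm_num) (add_nonneg (add_nonneg (add_nonneg (mul_nonneg (mul_nonneg (mul_nonneg (mul_nonneg hu1 hu1) hu1) hu1) h10) (mul_nonneg (mul_nonneg (mul_nonneg (mul_nonneg hu2 hu2) hu2) hu2) h20)) (mul_nonneg (mul_nonneg (mul_nonneg (mul_nonneg hu3 hu3) hu3) hu3) h30)) (mul_nonneg (mul_nonneg (mul_nonneg (mul_nonneg hu4 hu4)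 hu4) hu4) h40)))) (mul_nonneg (by norm_num) (mul_nonneg (mul_nonneg (mul_nonneg (mul_nonneg hu1 hu2) hu3) hu4) hr2))) (mul_nonneg (by norm_num) (add_nonneg (add_nonneg (add_nonneg (add_nonneg (add_nonneg (mul_nonneg (mul_nonneg (mul_nonneg (mul_nonneg hu1 hu2) h30) h40) hr2) (mul_nonneg (mul_nonneg (mul_nonneg (mul_nonneg hu1 h20) hu3) h40) hr2)) (mul_nonneg (mul_nonneg (mul_nonneg (mul_nonneg hu1 h20) h30) hu4) hr2)) (mul_nonneg (mul_nonneg (mul_nonneg (mul_nonneg h10 hu2) hu3) h40) hr2)) (mul_nonneg (mul_nonneg (mul_nonneg (mul_nonneg h10 hu2) h30) hu4) hr2)) (mul_nonneg (mul_nonneg (mul_nonneg (mul_nonneg h10 h20) hu3) hu4) hr2)))) (mul_nonneg (by norm_num) (add_nonneg (add_nonneg (add_nonneg (mul_nonneg (mul_nonneg (mul_nonneg (mul_nonneg hu1 hu1) hu1) h10) hr5) (mul_nonneg (mul_nonneg (mul_nonneg (mul_nonneg hu2 hu2) hu2) h20) hr5)) (mul_nonneg (mul_nonneg (mul_nonneg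 (mul_nonneg hu3 hu3) hu3) h30) hr5)) (mul_nonneg (mul_nonneg (mul_nonneg (mul_nonneg hu4 hu4) hu4) h40) hr5)))) (mul_nonneg (by norm_num) hsig)) (mul_nonneg (by norm_num) (mul_nonneg hr2 hr2))) (mul_nonneg (by norm_num) (add_nonneg (add_nonneg (add_nonneg (mul_nonneg (mul_nonneg (mul_nonneg hu1 h10) hr2) hr2) (mul_nonneg (mul_nonneg (mul_nonneg hu2 h20) hr2) hr2)) (mul_nonneg (mul_nonneg (mul_nonneg hu3 h30) hr2) hr2)) (mul_nonneg (mul_nonneg (mul_nonneg hu4 h40) hr2) hr2)))) (mul_nonneg (by norm_num) (add_nonneg (add_nonneg (add_nonneg (add_nonneg (add_nonneg (add_nonneg (add_nonneg (add_nonneg (add_nonneg (add_nonneg (add_nonneg (mul_nonneg (mul_nonneg (mul_nonneg (mul_nonneg hu1 h20) h30) hr2) hr2) (mul_nonneg (mul_nonneg (mul_nonneg (mul_nonneg hu1 h20) h40) hr2) hr2)) (mul_nonneg (mul_nonneg (mul_nonneg (mul_nonneg hu1 h30) h40) hr2) hr2)) (mul_nonneg (mul_nonneg (mul_nonneg (mul_nonneg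 h10 hu2) h30) hr2) hr2)) (mul_nonneg (mul_nonneg (mul_nonneg (mul_nonneg h10 hu2) h40) hr2) hr2)) (mul_nonneg (mul_nonneg (mul_nonneg (mul_nonneg h10 h20) hu3) hr2) hr2)) (mul_nonneg (mul_nonneg (mul_nonneg (mul_nonneg h10 h20) hu4) hr2) hr2)) (mul_nonneg (mul_nonneg (mul_nonneg (mul_nonneg h10 hu3) h40) hr2) hr2)) (mul_nonneg (mul_nonneg (mul_nonneg (mul_nonneg h10 h30) hu4) hr2) hr2)) (mul_nonneg (mul_nonneg (mul_nonneg (mul_nonneg hu2 h30) h40) hr2) hr2)) (mul_nonneg (mul_nonneg (mul_nonneg (mul_nonneg h20 hu3) h40) hr2) hr2)) (mul_nonneg (mul_nonneg (mul_nonneg (mul_nonneg h20 h30) hu4) hr2) hr2)))) (mul_nonneg (by norm_num) (add_nonneg (add_nonneg (add_nonneg (add_nonneg (add_nonneg (mul_nonneg (mul_nonneg (mul_nonneg hu1 hu2) hr2) hr5) (mul_nonneg (mul_nonneg (mul_nonneg hu1 hu3) hr2) hr5)) (mul_nonneg (mul_nonneg (mul_nonneg hu1 hu4) hr2) hr5))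 (mul_nonneg (mul_nonneg (mul_nonneg hu2 hu3) hr2) hr5)) (mul_nonneg (mul_nonneg (mul_nonneg hu2 hu4) hr2) hr5)) (mul_nonneg (mul_nonneg (mul_nonneg hu3 hu4) hr2) hr5)))) (mul_nonneg (by norm_num) (mul_nonneg hr5 hsig))) (mul_nonneg (by norm_num) (add_nonneg (add_nonneg (add_nonneg (add_nonneg (add_nonneg (add_nonneg (add_nonneg (add_nonneg (add_nonneg (add_nonneg (add_nonneg (mul_nonneg (mul_nonneg (mul_nonneg hu3 hu3) hu3) (sq_nonneg (g₁ - g₂))) (mul_nonneg (mul_nonneg (mul_nonneg hu4 hu4) hu4) (sq_nonneg (g₁ - g₂)))) (mul_nonneg (mul_nonneg (mul_nonneg hu2 hu2) hu2) (sq_nonneg (g₁ - g₃)))) (mul_nonneg (mul_nonneg (mul_nonneg hu2 hu2) hu2) (sq_nonneg (g₁ - g₄)))) (mul_nonneg (mul_nonneg (mul_nonneg hu4 hu4) hu4) (sq_nonneg (g₁ - g₃)))) (mul_nonneg (mul_nonneg (mul_nonneg hu3 hu3) hu3) (sq_nonneg (g₁ - g₄)))) (mul_nonneg (mul_nonneg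 (mul_nonneg hu1 hu1) hu1) (sq_nonneg (g₂ - g₃)))) (mul_nonneg (mul_nonneg (mul_nonneg hu1 hu1) hu1) (sq_nonneg (g₂ - g₄)))) (mul_nonneg (mul_nonneg (mul_nonneg hu1 hu1) hu1) (sq_nonneg (g₃ - g₄)))) (mul_nonneg (mul_nonneg (mul_nonneg hu4 hu4) hu4) (sq_nonneg (g₂ - g₃)))) (mul_nonneg (mul_nonneg (mul_nonneg hu3 hu3) hu3) (sq_nonneg (g₂ - g₄)))) (mul_nonneg (mul_nonneg (mul_nonneg hu2 hu2) hu2) (sq_nonneg (g₃ - g₄)))))) (mul_nonneg (by norm_num) (add_nonneg (add_nonneg (add_nonneg (add_nonneg (add_nonneg (add_nonneg (add_nonneg (add_nonneg (add_nonneg (add_nonneg (add_nonneg (mul_nonneg (mul_nonneg (mul_nonneg hu3 hu3) h40) (sq_nonneg (g₁ - g₂))) (mul_nonneg (mul_nonneg (mul_nonneg h30 hu4) hu4) (sq_nonneg (g₁ - g₂)))) (mul_nonneg (mul_nonneg (mul_nonneg hu2 hu2) h40) (sq_nonneg (g₁ - g₃)))) (mul_nonneg (mul_nonneg (mul_nonneg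 hu2 hu2) h30) (sq_nonneg (g₁ - g₄)))) (mul_nonneg (mul_nonneg (mul_nonneg h20 hu4) hu4) (sq_nonneg (g₁ - g₃)))) (mul_nonneg (mul_nonneg (mul_nonneg h20 hu3) hu3) (sq_nonneg (g₁ - g₄)))) (mul_nonneg (mul_nonneg (mul_nonneg hu1 hu1) h40) (sq_nonneg (g₂ - g₃)))) (mul_nonneg (mul_nonneg (mul_nonneg hu1 hu1) h30) (sq_nonneg (g₂ - g₄)))) (mul_nonneg (mul_nonneg (mul_nonneg hu1 hu1) h20) (sq_nonneg (g₃ - g₄)))) (mul_nonneg (mul_nonneg (mul_nonneg h10 hu4) hu4) (sq_nonneg (g₂ - g₃)))) (mul_nonneg (mul_nonneg (mul_nonneg h10 hu3) hu3) (sq_nonneg (g₂ - g₄)))) (mul_nonneg (mul_nonneg (mul_nonneg h10 hu2) hu2) (sq_nonneg (g₃ - g₄)))))) (mul_nonneg (by norm_num) (add_nonneg (add_nonneg (add_nonneg (add_nonneg (add_nonneg (mul_nonneg (mul_nonneg (sq_nonneg (g₁ - g₂)) hr2) hr2) (mul_nonneg (mul_nonneg (sq_nonneg (g₁ - g₃))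 hr2) hr2)) (mul_nonneg (mul_nonneg (sq_nonneg (g₁ - g₄)) hr2) hr2)) (mul_nonneg (mul_nonneg (sq_nonneg (g₂ - g₃)) hr2) hr2)) (mul_nonneg (mul_nonneg (sq_nonneg (g₂ - g₄)) hr2) hr2)) (mul_nonneg (mul_nonneg (sq_nonneg (g₃ - g₄)) hr2) hr2)))) (mul_nonneg (by norm_num) (add_nonneg (add_nonneg (add_nonneg (add_nonneg (add_nonneg (add_nonneg (add_nonneg (add_nonneg (add_nonneg (add_nonneg (add_nonneg (mul_nonneg (mul_nonneg (mul_nonneg h30 (sq_nonneg (g₁ - g₂))) hr2) hr2) (mul_nonneg (mul_nonneg (mul_nonneg h40 (sq_nonneg (g₁ - g₂))) hr2) hr2)) (mul_nonneg (mul_nonneg (mul_nonneg h20 (sq_nonneg (g₁ - g₃))) hr2) hr2)) (mul_nonneg (mul_nonneg (mul_nonneg h20 (sq_nonneg (g₁ - g₄))) hr2) hr2)) (mul_nonneg (mul_nonneg (mul_nonneg h40 (sq_nonneg (g₁ - g₃))) hr2) hr2)) (mul_nonneg (mul_nonneg (mul_nonneg h30 (sq_nonneg (g₁ - g₄))) hr2)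 hr2)) (mul_nonneg (mul_nonneg (mul_nonneg h10 (sq_nonneg (g₂ - g₃))) hr2) hr2)) (mul_nonneg (mul_nonneg (mul_nonneg h10 (sq_nonneg (g₂ - g₄))) hr2) hr2)) (mul_nonneg (mul_nonneg (mul_nonneg h10 (sq_nonneg (g₃ - g₄))) hr2) hr2)) (mul_nonneg (mul_nonneg (mul_nonneg h40 (sq_nonneg (g₂ - g₃))) hr2) hr2)) (mul_nonneg (mul_nonneg (mul_nonneg h30 (sq_nonneg (g₂ - g₄))) hr2) hr2)) (mul_nonneg (mul_nonneg (mul_nonneg h20 (sq_nonneg (g₃ - g₄))) hr2) hr2))))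


/-! ### The law of four blobs of a common size, atom by atom -/

/-- slicing a four-term point-mass combination. [folklore] -/
theorem slice_apply_lin4 (c₁ c₂ c₃ c₄ : ℝ) (n₁ n₂ n₃ n₄ a : ℕ) (g : ℝ) (h : ℕ) :
    slice (fun k => c₁ * pointLaw n₁ k + c₂ * pointLaw n₂ k + c₃ * pointLaw n₃ k + c₄ * pointLaw n₄ k) a g h =
      (1 - g) * (c₁ * pointLaw n₁ h + c₂ * pointLaw n₂ h + c₃ * pointLaw n₃ h + c₄ * pointLaw n₄ h) +
        g * (c₁ * pointLaw (a + n₁) h + c₂ * pointLaw (a + n₂) h + c₃ * pointLaw (a + n₃) h + c₄ * pointLaw (a + n₄) h) := by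
  simp only [slice]
  rw [show (if a ≤ h then c₁ * pointLaw n₁ (h - a) + c₂ * pointLaw n₂ (h - a) + c₃ * pointLaw n₃ (h - a) + c₄ * pointLaw n₄ (h - a) else 0) =
      c₁ * (if a ≤ h then pointLaw n₁ (h - a) else 0) + c₂ * (if a ≤ h then pointLaw n₂ (h - a) else 0) +
        c₃ * (if a ≤ h then pointLaw n₃ (h - a) else 0) + c₄ * (if a ≤ h then pointLaw n₄ (h - a) else 0) by split_ifs <;> ring,
    halfPt_shift, halfPt_shift, halfPt_shift, halfPt_shift]

/-- **four blobs `(k, gᵢ)` atom by atom**: `p₀ δ₀ + p₁ δ_k + p₂ δ_{2k} + p₃ δ_{3k} + p₄ δ_{4k}` with the symmetric weights. [this work] -/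
theorem blobLaw_four_apply (k : ℕ) (g₁ g₂ g₃ g₄ : ℝ) (h : ℕ) :
    blobLaw [(k, g₁), (k, g₂), (k, g₃), (k, g₄)] h
      = ((1 - g₁) * (1 - g₂) * (1 - g₃) * (1 - g₄)) * pointLaw 0 h + (g₁ * (1 - g₂) * (1 - g₃) * (1 - g₄) + (1 - g₁) * g₂ * (1 - g₃) * (1 - g₄) + (1 - g₁) * (1 - g₂) * g₃ * (1 - g₄) + (1 - g₁) * (1 - g₂) * (1 - g₃) * g₄) * pointLaw k h + (g₁ * g₂ * (1 - g₃) * (1 - g₄) + g₁ * (1 - g₂) * g₃ * (1 - g₄) + g₁ * (1 - g₂) * (1 - g₃) * g₄ + (1 - g₁) * g₂ * g₃ * (1 - g₄) + (1 - g₁) * g₂ * (1 - g₃) * g₄ + (1 - g₁) * (1 - g₂) * g₃ * g₄) * pointLaw (2 * k) h + ((1 - g₁) * g₂ * g₃ * g₄ + g₁ * (1 - g₂) * g₃ * g₄ + g₁ * g₂ * (1 - g₃) * g₄ + g₁ * g₂ * g₃ * (1 - g₄)) * pointLaw (3 * k) h + (g₁ * g₂ * g₃ * g₄) * pointLaw (4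 * k) h := by
  have e4 : blobLaw [(k, g₄)] = fun t => (1 - g₄) * pointLaw 0 t + g₄ * pointLaw k t := funext fun t => blobLaw_one_apply k g₄ t
  have e3 : blobLaw [(k, g₃), (k, g₄)]
      = fun t => (1 - g₃) * (1 - g₄) * pointLaw 0 t + ((1 - g₃) * g₄ + g₃ * (1 - g₄)) * pointLaw k t + g₃ * g₄ * pointLaw (2 * k) t := by
    funext t
    show slice (blobLaw [(k, g₄)]) k g₃ t = _
    rw [e4, slice_apply_lin2, Nat.add_zero, show k + k = 2 * k by ring]
    ring
  have e2 : blobLaw [(k, g₂), (k, g₃), (k, g₄)]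
      = fun t => (1 - g₂) * (1 - g₃) * (1 - g₄) * pointLaw 0 t
          + (g₂ * (1 - g₃) * (1 - g₄) + (1 - g₂) * g₃ * (1 - g₄) + (1 - g₂) * (1 - g₃) * g₄) * pointLaw k t
          + (g₂ * g₃ * (1 - g₄) + g₂ * (1 - g₃) * g₄ + (1 - g₂) * g₃ * g₄) * pointLaw (2 * k) t
          + g₂ * g₃ * g₄ * pointLaw (3 * k) t := by
    funext t
    show slice (blobLaw [(k, g₃), (k, g₄)]) k g₂ t = _
    rw [e3, slice_apply_lin3, Nat.add_zero, show k + k = 2 * k by ring, show k + 2 * k = 3 * k by ring]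
    ring
  show slice (blobLaw [(k, g₂), (k, g₃), (k, g₄)]) k g₁ h = _
  rw [e2, slice_apply_lin4, Nat.add_zero, show k + k = 2 * k by ring, show k + 2 * k = 3 * k by ring, show k + 3 * k = 4 * k by ring]
  ring

/-! ### BLOB-AFL(4) for arbitrary gates -/

/-- **FOUR BLOBS WITH ARBITRARY GATES ARE HEAVY-DEC AT THEIR AVERAGE GATE.**  For a blob size `k` and gates `g₁..g₄ ∈ [0,1]` with
`0 < s = Σgᵢ < 4`, the law of `k·(ξ₁+ξ₂+ξ₃+ξ₄)` on `{0..4k}` is an exact mixture of components `{lo, hi; γ}` with `γ ≥ s/4` and credit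
`2·lo + (hi−lo)·γ ≥ s·k` — the five-atom regimes of census-2 g80 with the capacities of this file.  Generalises `heavy_fourBlobs` (gates `(g,g,g,cg)`).
[this work] -/
theorem heavy_fourBlobs_gates (k : ℕ) {g₁ g₂ g₃ g₄ : ℝ} (h₁0 : 0 ≤ g₁) (h₁1 : g₁ ≤ 1) (h₂0 : 0 ≤ g₂) (h₂1 : g₂ ≤ 1)
    (h₃0 : 0 ≤ g₃) (h₃1 : g₃ ≤ 1) (h₄0 : 0 ≤ g₄) (h₄1 : g₄ ≤ 1) (hs0 : 0 < g₁ + g₂ + g₃ + g₄) (hs4 : g₁ + g₂ + g₃ + g₄ < 4) :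
    ∃ (ι : Type) (_ : Fintype ι) (lam γ : ι → ℝ) (lo hi : ι → ℕ),
      (∀ i, 0 ≤ lam i) ∧ (∑ i, lam i = 1) ∧ (∀ i, 0 ≤ γ i ∧ γ i ≤ 1) ∧ (∀ i, lo i ≤ hi i) ∧ (∀ i, hi i ≤ 4 * k) ∧
      (∀ h, blobLaw [(k, g₁), (k, g₂), (k, g₃), (k, g₄)] h = ∑ i, lam i * TP[lo i, hi i, γ i, h]) ∧
      (∀ i, 0 < lam i → (g₁ + g₂ + g₃ + g₄) / 4 ≤ γ i ∧ (g₁ + g₂ + g₃ + g₄) * k ≤ 2 * (lo i : ℝ) + ((hi i : ℝ) - lo i) * γ i) := by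
  have hu₁ : 0 ≤ 1 - g₁ := by linarith
  have hu₂ : 0 ≤ 1 - g₂ := by linarith
  have hu₃ : 0 ≤ 1 - g₃ := by linarith
  have hu₄ : 0 ≤ 1 - g₄ := by linarith
  -- the five atoms: nonnegative, mass one, mean `s`
  have hp₀0 : 0 ≤ ((1 - g₁) * (1 - g₂) * (1 - g₃) * (1 - g₄)) := mul_nonneg (mul_nonneg (mul_nonneg hu₁ hu₂) hu₃) hu₄
  have hp₁0 : 0 ≤ (g₁ * (1 - g₂) * (1 - g₃) * (1 - g₄) + (1 - g₁) * g₂ * (1 - g₃) * (1 - g₄) + (1 - g₁) * (1 - g₂) * g₃ * (1 - g₄) + (1 - g₁) * (1 - g₂) * (1 - g₃) * g₄) :=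
    add_nonneg (add_nonneg (add_nonneg (mul_nonneg (mul_nonneg (mul_nonneg h₁0 hu₂) hu₃) hu₄)
      (mul_nonneg (mul_nonneg (mul_nonneg hu₁ h₂0) hu₃) hu₄)) (mul_nonneg (mul_nonneg (mul_nonneg hu₁ hu₂) h₃0) hu₄))
      (mul_nonneg (mul_nonneg (mul_nonneg hu₁ hu₂) hu₃) h₄0)
  have hp₂0 : 0 ≤ (g₁ * g₂ * (1 - g₃) * (1 - g₄) + g₁ * (1 - g₂) * g₃ * (1 - g₄) + g₁ * (1 - g₂) * (1 - g₃) * g₄ + (1 - g₁) * g₂ * g₃ * (1 - g₄) + (1 - g₁) * g₂ * (1 - g₃) * g₄ + (1 - g₁) * (1 - g₂) * g₃ * g₄) :=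
    add_nonneg (add_nonneg (add_nonneg (add_nonneg (add_nonneg
      (mul_nonneg (mul_nonneg (mul_nonneg h₁0 h₂0) hu₃) hu₄) (mul_nonneg (mul_nonneg (mul_nonneg h₁0 hu₂) h₃0) hu₄))
      (mul_nonneg (mul_nonneg (mul_nonneg h₁0 hu₂) hu₃) h₄0)) (mul_nonneg (mul_nonneg (mul_nonneg hu₁ h₂0) h₃0) hu₄))
      (mul_nonneg (mul_nonneg (mul_nonneg hu₁ h₂0) hu₃) h₄0)) (mul_nonneg (mul_nonneg (mul_nonneg hu₁ hu₂) h₃0) h₄0)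
  have hp₃0 : 0 ≤ ((1 - g₁) * g₂ * g₃ * g₄ + g₁ * (1 - g₂) * g₃ * g₄ + g₁ * g₂ * (1 - g₃) * g₄ + g₁ * g₂ * g₃ * (1 - g₄)) :=
    add_nonneg (add_nonneg (add_nonneg (mul_nonneg (mul_nonneg (mul_nonneg hu₁ h₂0) h₃0) h₄0)
      (mul_nonneg (mul_nonneg (mul_nonneg h₁0 hu₂) h₃0) h₄0)) (mul_nonneg (mul_nonneg (mul_nonneg h₁0 h₂0) hu₃) h₄0))
      (mul_nonneg (mul_nonneg (mul_nonneg h₁0 h₂0) h₃0) hu₄)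
  have hp₄0 : 0 ≤ (g₁ * g₂ * g₃ * g₄) := mul_nonneg (mul_nonneg (mul_nonneg h₁0 h₂0) h₃0) h₄0
  have hsum : ((1 - g₁) * (1 - g₂) * (1 - g₃) * (1 - g₄)) + (g₁ * (1 - g₂) * (1 - g₃) * (1 - g₄) + (1 - g₁) * g₂ * (1 - g₃) * (1 - g₄) + (1 - g₁) * (1 - g₂) * g₃ * (1 - g₄) + (1 - g₁) * (1 - g₂) * (1 - g₃) * g₄) + (g₁ * g₂ * (1 - g₃) * (1 - g₄) + g₁ * (1 - g₂) * g₃ * (1 - g₄) + g₁ * (1 - g₂) * (1 - g₃) * g₄ + (1 - g₁) * g₂ * g₃ * (1 - g₄) + (1 - g₁) * g₂ * (1 - g₃) * g₄ + (1 - g₁) * (1 - g₂) * g₃ * g₄) + ((1 - g₁) * g₂ * g₃ * g₄ + g₁ * (1 - g₂) * g₃ * g₄ + g₁ * g₂ * (1 - g₃) * g₄ + g₁ * g₂ * g₃ * (1 - g₄)) + (g₁ * g₂ * g₃ * g₄) = 1 := by ring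
  have hmean : (g₁ * (1 - g₂) * (1 - g₃) * (1 - g₄) + (1 - g₁) * g₂ * (1 - g₃) * (1 - g₄) + (1 - g₁) * (1 - g₂) * g₃ * (1 - g₄) + (1 - g₁) * (1 - g₂) * (1 - g₃) * g₄) + 2 * (g₁ * g₂ * (1 - g₃) * (1 - g₄) + g₁ * (1 - g₂) * g₃ * (1 - g₄) + g₁ * (1 - g₂) * (1 - g₃) * g₄ + (1 - g₁) * g₂ * g₃ * (1 - g₄) + (1 - g₁) * g₂ * (1 - g₃) * g₄ + (1 - g₁) * (1 - g₂) * g₃ * g₄) + 3 * ((1 - g₁) * g₂ * g₃ * g₄ + g₁ * (1 - g₂) * g₃ * g₄ + g₁ * g₂ * (1 - g₃) * g₄ + g₁ * g₂ * g₃ * (1 - g₄)) + 4 * (g₁ * g₂ * g₃ * g₄) = (g₁ + g₂ + g₃ + g₄) := by ring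
  have hlaw : ∀ h : ℕ, blobLaw [(k, g₁), (k, g₂), (k, g₃), (k, g₄)] h
      = ((1 - g₁) * (1 - g₂) * (1 - g₃) * (1 - g₄)) * (if h = 0 then (1 : ℝ) else 0) + (g₁ * (1 - g₂) * (1 - g₃) * (1 - g₄) + (1 - g₁) * g₂ * (1 - g₃) * (1 - g₄) + (1 - g₁) * (1 - g₂) * g₃ * (1 - g₄) + (1 - g₁) * (1 - g₂) * (1 - g₃) * g₄) * (if h = k then (1 : ℝ) else 0) + (g₁ * g₂ * (1 - g₃) * (1 - g₄) + g₁ * (1 - g₂) * g₃ * (1 - g₄) + g₁ * (1 - g₂) * (1 - g₃) * g₄ + (1 - g₁) * g₂ * g₃ * (1 - g₄) + (1 - g₁) * g₂ * (1 - g₃) * g₄ + (1 - g₁) * (1 - g₂) * g₃ * g₄) * (if h = 2 * k then (1 : ℝ) else 0)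
        + ((1 - g₁) * g₂ * g₃ * g₄ + g₁ * (1 - g₂) * g₃ * g₄ + g₁ * g₂ * (1 - g₃) * g₄ + g₁ * g₂ * g₃ * (1 - g₄)) * (if h = 3 * k then (1 : ℝ) else 0) + (g₁ * g₂ * g₃ * g₄) * (if h = 4 * k then (1 : ℝ) else 0) := by
    intro h
    rw [blobLaw_four_apply]
    simp only [pointLaw_apply]
  -- the five regimes of `s`
  have main : ∃ (ι : Type) (_ : Fintype ι) (lam γ : ι → ℝ) (lo hi : ι → ℕ),
      (∀ i, 0 ≤ lam i) ∧ (∑ i, lam i = 1) ∧ (∀ i, 0 ≤ γ i ∧ γ i ≤ 1) ∧ (∀ i, lo i ≤ hi i) ∧ (∀ i, hi i ≤ 4 * k) ∧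
      (∀ h, (((1 - g₁) * (1 - g₂) * (1 - g₃) * (1 - g₄)) * (if h = 0 then (1 : ℝ) else 0) + (g₁ * (1 - g₂) * (1 - g₃) * (1 - g₄) + (1 - g₁) * g₂ * (1 - g₃) * (1 - g₄) + (1 - g₁) * (1 - g₂) * g₃ * (1 - g₄) + (1 - g₁) * (1 - g₂) * (1 - g₃) * g₄) * (if h = k then (1 : ℝ) else 0) + (g₁ * g₂ * (1 - g₃) * (1 - g₄) + g₁ * (1 - g₂) * g₃ * (1 - g₄) + g₁ * (1 - g₂) * (1 - g₃) * g₄ + (1 - g₁) * g₂ * g₃ * (1 - g₄) + (1 - g₁) * g₂ * (1 - g₃) * g₄ + (1 - g₁) * (1 - g₂) * g₃ * g₄) * (if h = 2 * k then (1 : ℝ) else 0)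
          + ((1 - g₁) * g₂ * g₃ * g₄ + g₁ * (1 - g₂) * g₃ * g₄ + g₁ * g₂ * (1 - g₃) * g₄ + g₁ * g₂ * g₃ * (1 - g₄)) * (if h = 3 * k then (1 : ℝ) else 0) + (g₁ * g₂ * g₃ * g₄) * (if h = 4 * k then (1 : ℝ) else 0))
          = ∑ i, lam i * TP[lo i, hi i, γ i, h]) ∧
      (∀ i, 0 < lam i → (g₁ + g₂ + g₃ + g₄) / 4 ≤ γ i ∧ (g₁ + g₂ + g₃ + g₄) * k ≤ 2 * (lo i : ℝ) + ((hi i : ℝ) - lo i) * γ i) := by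
    rcases le_or_gt (g₁ + g₂ + g₃ + g₄) 1 with h1 | h1
    · exact heavy_fiveAtoms_r1 k _ _ _ _ _ _ hp₀0 hp₁0 hp₂0 hp₃0 hp₄0 hsum hmean hs0 h1
    rcases le_or_gt (g₁ + g₂ + g₃ + g₄) 2 with h2 | h2
    · exact heavy_fiveAtoms_r2 k _ _ _ _ _ _ hp₀0 hp₁0 hp₂0 hp₃0 hp₄0 hsum hmean hs0 h1 h2
    rcases le_or_gt (g₁ + g₂ + g₃ + g₄) (8 / 3) with h83 | h83
    · exact heavy_fiveAtoms_r3lo k _ _ _ _ _ _ hp₀0 hp₁0 hp₂0 hp₃0 hp₄0 hsum hmean hs0 h2 h83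
        (fourGates_capacity_C2 h₁0 h₁1 h₂0 h₂1 h₃0 h₃1 h₄0 h₄1 h83 h2.le)
        (fourGates_capacity_Z h₁0 h₁1 h₂0 h₂1 h₃0 h₃1 h₄0 h₄1 (by linarith) h2.le)
    rcases lt_or_ge (g₁ + g₂ + g₃ + g₄) 3 with h3 | h3
    · refine heavy_fiveAtoms_r3hi k _ _ _ _ _ _ hp₀0 hp₁0 hp₂0 hp₃0 hp₄0 hsum hmean hs0 h83.le h3
        (fourGates_capacity_Z h₁0 h₁1 h₂0 h₂1 h₃0 h₃1 h₄0 h₄1 h3.le h2.le)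
        (fourGates_capacity_O h₁0 h₁1 h₂0 h₂1 h₃0 h₃1 h₄0 h₄1 h3.le h83.le) ?_
      by_cases hcase : (g₁ * g₂ * g₃ * g₄) ≤ 3 * ((1 - g₁) * (1 - g₂) * (1 - g₃) * (1 - g₄))
      · exact Or.inr (fourGates_capacity_Sep h₁0 h₁1 h₂0 h₂1 h₃0 h₃1 h₄0 h₄1 h3.le h83.le hcase)
      · left
        have hlt : 3 * ((1 - g₁) * (1 - g₂) * (1 - g₃) * (1 - g₄)) < (g₁ * g₂ * g₃ * g₄) := lt_of_not_ge hcase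
        nlinarith [hp₄0, hp₀0]
    · exact heavy_fiveAtoms_r4 k _ _ _ _ _ _ hp₀0 hp₁0 hp₂0 hp₃0 hp₄0 hsum hmean hs0 h3 hs4
        (fourGates_capacity_A h₁0 h₁1 h₂0 h₂1 h₃0 h₃1 h₄0 h₄1 h3) (fourGates_capacity_S h₁0 h₁1 h₂0 h₂1 h₃0 h₃1 h₄0 h₄1 h3)
  obtain ⟨ι, hι, lam, γ, lo, hi, a0, a1, aγ, alohi, ahi, aμ, aval⟩ := main
  exact ⟨ι, hι, lam, γ, lo, hi, a0, a1, aγ, alohi, ahi, fun h => (hlaw h).trans (aμ h), aval⟩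

/-- **hence DEC at every layer**: four blobs with arbitrary gates, at the average gate and the mean. [this work] -/
theorem decAtT_fourBlobs_gates (k : ℕ) {g₁ g₂ g₃ g₄ : ℝ} (h₁0 : 0 ≤ g₁) (h₁1 : g₁ ≤ 1) (h₂0 : 0 ≤ g₂) (h₂1 : g₂ ≤ 1)
    (h₃0 : 0 ≤ g₃) (h₃1 : g₃ ≤ 1) (h₄0 : 0 ≤ g₄) (h₄1 : g₄ ≤ 1) (hs0 : 0 < g₁ + g₂ + g₃ + g₄) (hs4 : g₁ + g₂ + g₃ + g₄ < 4) (j : ℕ) :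
    DECAtT ((g₁ + g₂ + g₃ + g₄) / 4) ((g₁ + g₂ + g₃ + g₄) * k) j (4 * k) (blobLaw [(k, g₁), (k, g₂), (k, g₃), (k, g₄)]) :=
  decAtT_of_heavy _ _ _ _ (heavy_fourBlobs_gates k h₁0 h₁1 h₂0 h₂1 h₃0 h₃1 h₄0 h₄1 hs0 hs4) j

end LawDec
end Quant
end Summit.CriticalPhenomena.PercolationContinuityZ3.Theorems
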